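import Summits.QuantumFields.YangMills.Theorems.BalabanUVNodesN06StateLayerAtPinsPUWPar
import Summits.QuantumFields.YangMills.Theorems.BalabanUVNodesN06TbHLegAtPinsPhysPUParJ
import Summits.QuantumFields.YangMills.Theorems.BalabanUVNodesN06LettersSAtPinsPUParJ
import Summits.QuantumFields.YangMills.Theorems.BalabanUVNodesN06StatePairsAtPinsPUJ
import Summits.QuantumFields.YangMills.Theorems.BalabanUVNodesN06StateAssemblyAtPinsPUWJ
/-!
# BalabanUVNodes ∕ N06 ([B9], `Dag.B9_main`) — R1 J-TWIN (STATE MACHINERY 5∕5): ★★★ THE U8 STATE LAYER AT THE PINS, SITE-TRANSPORTER-PARAMETRIC, ALONG A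
# SUB-FAMILY `f : J → MemberY …` — the J-twin of ✓`…N06StateLayerAtPinsPUWPar.hStateTuplesW_of_pinsP_geo9Y_par` (dag-n06-d g26, CASCADE-K «K3-D»)
Track A of `YM-PLAN.md` (cell `pub-ymgap`, HUMAN RULING D-0062), node **N06** = [Balaban1985BackgroundPropagators]; IR-N06-SECTION-2 road **R1** («J-twin of the
producer cone», ★★★ director-ym №524 (3): STAGED, sibling files only), `R1-JTWIN-SPEC.md` rule (R)′: re-key EXACTLY the section-tainted ∀-member rows along `f`, keep
data ∕ pins ∕ laws ∕ section-free rows member-wide, tainted conclusions along `f` ((R).3′).  Seat `pub-ymgap-dag-n06-d` g30.  THIS IS THE FILE dag-n06-l's (7)ᴶ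
(`…GDSupSubLegAtPinsPUWIPar`ᴶ, PASS 1 at Δ⁽²⁾ := 0), (10)ᴶ (`…D2SupPrechainV2AtPinsPUWQ`ᴶ) and L1ᴶ (`…Level13D2LayerAtPinsPUWParQ`ᴶ) WAIT ON (their memo
`R1-PATH-CENSUS-MEMO.md` §7–§8, dag-lead WORDS 675); it also serves `…N06Rgdd13AtPinsPUWPar`ᴶ (same tainted set at its call site, kernel-read).
WHAT.  `hStateTuplesW_of_pinsP_geo9Y_par_J` = the parent's theorem with `{J : Type} (f : J → MemberY d ℓ hd hL b₀ b₁ Mstar)` added after the `H` binder and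
* TAINTED ROWS OF THIS TWIN (the union over its three callers, kernel-read): `h49` ((3.49) ⟸ (3.48) rows 15∕16 via `…Proj349AtPinsPhysRCPar`), `hta` (T_a ⟸ the
  (3.49)-split `…SplitMajorantsAtPinsPhysRPar`), `hD2` (the Δ⁽²⁾ letter (3.137) ⟸ row 17 via dag-n06-l's (8)–(10); at PASS 1 the flat zero letter) — each re-keyed
  `∀ x : MemberY … ↦ ∀ j : J`, read at `f j`;
* LEFT member-wide (section-free, rule (R).1′): `h31 h43 h44G hBJ hZ81 hpXDv hpXQs hgQs1 he2 h43RG hdgDvd htransW hdgDH hdgDHd hYd hXd he0 he1 he1d h43L h43d hDir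
  hDirR` (Theorem 3.1, the (3.43)∕(3.44) displays, the current letters, Theorem 3.3's G₀ layer, the DgDvd∕XdYd∕Dv∕G₀Q⋆ legs' outputs), every letter family ∕ pin ∕ law ∕
  instance binder, all x-free numerics and the rate budget;
* conclusion `∃ MT θS θD A₀S AW AQ AD AQ1 CR θH AI AV, (signs) ∧ ∀ j : J, MT ≤ (geo9Y (f j)).M → … hst20 ∧ hst10 ∧ hst21 ∧ hst11` — the four STATE TUPLES at `f j`
  (all four carry `StepS`∕pair components fed by the tainted letters, so the whole member clause is re-keyed, (R).3′).
PROOF = the parent's composition with the tainted calls redirected to the landed J-leaves and the section-free calls kept AS IS: STEP 0 ✓`…TbHLegAtPinsPhysPUParJ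
.htbH_of_pinsP43_geo9Y_par_J` (h49) → `hta' htbH'` along `f` → STEP 1 ✓`…LettersSAtPinsPUParJ.hLettersS_of_pinsP44_geo9Y_par_J` (h49 hD2 hta htbH) → STEP 2a∕2b the
member-wide faces ✓`hStateFacts_of_pinsP_geo9Y` ∕ ✓`hG0S2_of_pinsP_geo9Y` ∕ ✓`hProducersA_of_pinsP_geo9Y` ∕ ✓`hProducersBW_of_pinsP_geo9Y` UNCHANGED → STEP 2c
✓`…StatePairsAtPinsPUJ.hStatePairs_of_pinsP_geo9Y_J` (hLS along `f`, the G₀-layer rows member-wide) → STEP 3 ✓`…StateAssemblyAtPinsPUWJ.hStateAssemblyW_of_faces_J`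
(hPairs along `f`, the four producer faces member-wide); every constant chosen inside is the parent's closed expression verbatim (x-free).  The member-wide parent is
the instance `J := MemberY …`, `f := id`.  ORPHAN by design until (7)ᴶ∕(10)ᴶ∕L1ᴶ∕`…Rgdd13AtPinsPUWPar`ᴶ land (honest).
HONEST FRAMING.  Helper (plumbing of landed faces), COUNT-NEUTRAL (`--supports stmt-QuantumFields-27239 --as helper`); every displayed row is a HYPOTHESIS; nothing
of [B9] ∕ [4] asserted; N06 NOT discharged; K1 NOT closed; under R1 the inner-corner question stays DISPLAYED at the K1 face ∕ NODE O join by (α5); nothing continuum ∕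
OS ∕ mass gap ∕ Clay.  0 `def`, 0 `sorry`.  NEW file; the parent and the four member-wide faces untouched.  [cite: Balaban1985BackgroundPropagators, Thm 3.3 p.399, (3.42)–(3.47) pp.397–398, (3.130)–(3.133) pp.421–422, (3.137)–(3.138) p.423, (3.151)–(3.153) p.426; Balaban1984PropagatorsII, (2.51)–(2.56) pp.232–233, Lemma 2.1 (2.60)–(2.61) p.234]
-/
noncomputable section

namespace Summit.QuantumFields.YangMills.BalabanUVNodes.N06StateLayerAtPinsPUWParJ

open Literature.MathematicalPhysics.QuantumFieldTheory.Balaban1983to89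
open Literature.MathematicalPhysics.QuantumFieldTheory.Balaban1983to89.Node00 (FBondY IBondY SiteY CfgY SiteParY SiteOpY parSymY GpY GpPhysY BondOpY parBY BondParY)
open Literature.MathematicalPhysics.QuantumFieldTheory.Balaban1983to89.Node00.OpsYSectDCoords (DvcoKH DvscoKH TpicoK T2coK cR39_trBasis_pos)
open B9Thm39ReadingCoords (cR39 coordBound39 basisBound39)
open B9Thm34Ext (toB6)
open B11SectG (HasMaj BlockNorm)
open B9Thm312Whole (cNorm GeoOK)
open B9Thm312WholeClasses (cNormR rwt rwt_nonneg)
open B9CoReadingCoords (XBK blkBK coordOpK cdBₗ)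
open B9CoReadingCoordsS (XSK sIK blkSK GcoS)
open B9CoReadingCoordsH (XHK)
open B9CoReadingCoordsTranspose (TrIdx trBasis)
open B9PinMembersKLevelV1 (MemberY geo9Y)
open B9BackgroundsKLevelV1R (RegFamY bg9YR MemOfFam)
open B9GeoLemma21KLevelV1 (geo9Y_len_pos geo9Y_dist_triangle geo9Y_dist_comm)
open B9GeoNormsKLevelV1 (geo9K geo9K_dist_nonneg)
open B7Prop2SpecialUnitary (specialUnitaryUnits)
open B9PerturbationMajorantAlgebra (Proj349Maj Thm31GpMaj hasMaj_weaken)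
open B9PerturbationMajorantsAtLetters (PcoK)
open B9MultiscaleSmoothPartitionYNear (rNear)
open B9MultiscaleSmoothPartitionYLip (CLip CLip_nonneg)
open B9SmoothHolderClassP (bHZKP bHZKPG bHZPG)
open B9GradViaDivLettersTransported (taxiB taxiS)
open B9PerturbationSplitAtLetters (TaLcoK TbLcoKH Ta2LcoK Tb2LcoKH)
open B9PerturbationL2Delta2 (D2coK)
open B9SmoothHolderClassPProducers (CTel CTel_nonneg)
open B9RowSum261DefiniteFaces (rowConst261 rowConst261_nonneg)
open B9SectDSup (weightNorm)
open B6RandomWalk (HasMajorant)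
open B6RandomWalkHom (HasMajorantHom)
open B9Thm312WholeStepRegular (StepS LettersS3131)
open B9CoReadingCoordsHolder (PK)
open B9CoReadingCoordsHolderAdm (holderProbesKA)
open B9RWSums343Holder (HolderProbes)
open B9PerturbationMajorantAlgebra (CurrentMaj)
open B9PerturbationMajorantsAtLetters (BcoKH BdcoKH)
open B9Thm313WholeDir (Thm33G0DirR)
open B9Thm313WholeDirInputBC (Letters313IML)
open B9LettersHZAtOne (plateau_pos)
open B9CoReadingCoordsInput (bHK) open B9CoReadingCoordsInputS (bHS)
open B9CoRealizesRelAtLetters (RelB)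
open B9Thm33G0ProbeZeroAtCutPins (pX0_of_pins)
open B6GlobalChartV1 (blkV1) open B6Ineq2142KLevelV1 (β lvl) open B6Geom246MultiLevelTorus (geomT)
open Summit.QuantumFields.YangMills.BalabanUVNodes.N06HolderPinsGradedAtRecord (links_le_one)
open Summit.QuantumFields.YangMills.BalabanUVNodes.N06TbHLegAtPinsPhysPU (htbH_of_pinsP43_geo9Y)
open Summit.QuantumFields.YangMills.BalabanUVNodes.N06LettersSAtPinsPU (hLettersS_of_pinsP44_geo9Y)
open Summit.QuantumFields.YangMills.BalabanUVNodes.N06StateClassFactsAtPinsPU (hStateFacts_of_pinsP_geo9Y)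
open Summit.QuantumFields.YangMills.BalabanUVNodes.N06StateProducerG0AtPinsPU (hG0S2_of_pinsP_geo9Y)
open Summit.QuantumFields.YangMills.BalabanUVNodes.N06StateProducersAAtPinsPU (hProducersA_of_pinsP_geo9Y)
open Summit.QuantumFields.YangMills.BalabanUVNodes.N06StateProducersBAtPinsPUW (hProducersBW_of_pinsP_geo9Y)
open Summit.QuantumFields.YangMills.BalabanUVNodes.N06StatePairsAtPinsPU (hStatePairs_of_pinsP_geo9Y)
open Summit.QuantumFields.YangMills.BalabanUVNodes.N06StateAssemblyAtPinsPUW (hStateAssemblyW_of_faces)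
open scoped Matrix.Norms.L2Operator

variable {N : ℕ} {d ℓ : ℕ} {hd : 1 ≤ d + 1} {hL : Odd (ℓ + 1) ∧ 1 < ℓ + 1} {b₀ b₁ : ℝ} {Mstar : ℕ}

set_option maxHeartbeats 1600000 in
/-- ★★★ **THE U8 STATE LAYER AT THE PINS** (module docstring): out of the certificate's displayed letters∕facts, the G₀ layer's outputs, the constants' signs and the rate budget for
`(δK, δP)`, the four STATE TUPLES of the S-leaves with EXISTENTIAL constants `θS θD θH A₀S AW AQ AD AQ1 CR AI AV` (and their signs), member-uniformly above a threshold `MT`.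
[cite: Balaban1985BackgroundPropagators, Thm 3.3 p.399, (3.42)–(3.47) pp.397–398, (3.130)–(3.131) pp.421–422, (3.138) p.423; Balaban1984PropagatorsII, (2.51)–(2.54) pp.232–233, (2.60)–(2.61) p.234] -/
theorem hStateTuplesW_of_pinsP_geo9Y_par_J
    (parT : ∀ i : B6KLevelCensusIndexV1.KIdx d ℓ hd hL b₀ b₁, Node00.SiteParY (Matrix (Fin N) (Fin N) ℂ) i) [NeZero N] [∀ x : MemberY d ℓ hd hL b₀ b₁ Mstar, Fintype (geo9Y x).Site] [∀ x : MemberY d ℓ hd hL b₀ b₁ Mstar, DecidableRel (RelB x.toKIdx)]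
    {R₁ R₂ : RegFamY d ℓ hd hL b₀ b₁ Mstar (Matrix (Fin N) (Fin N) ℂ)} (H : MemberY d ℓ hd hL b₀ b₁ Mstar → Prop) {J : Type} (f : J → MemberY d ℓ hd hL b₀ b₁ Mstar)
    (bI : ∀ x : MemberY d ℓ hd hL b₀ b₁ Mstar, FBondY x.toKIdx → IBondY x.toKIdx)
    (hlev : ∀ (x : MemberY d ℓ hd hL b₀ b₁ Mstar) (f : FBondY x.toKIdx), lvl x.hN x.D x.hk (bI x f) = (blkV1 x.hN x.D f).1.1)
    (hβ1 : ∀ (x : MemberY d ℓ hd hL b₀ b₁ Mstar) (f : FBondY x.toKIdx), (geomT x.D).dist (β x.hN x.D x.hk (bI x f)) (blkV1 x.hN x.D f) ≤ 1)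
    (hbI0 : ∀ (x : MemberY d ℓ hd hL b₀ b₁ Mstar) (f : FBondY x.toKIdx), bI x f = bI x ⟨f.src, 0⟩)
    (hGR : MemOfFam (specialUnitaryUnits (Fin N)) R₁)
    (c : ℝ) {M₀ a₀ : ℝ} (hM₀ : 0 ≤ M₀) {σ τ : ℝ} (hσ : 0 < σ) (hτ : 0 < τ)
    (w13 : ℝ → ℝ) (hw13₀ : ∀ s, 0 ≤ w13 s) (hw13₁ : ∀ s, w13 s ≤ 1) (wX : ℝ → ℝ) (hwX₀ : ∀ s, 0 ≤ wX s) (hwX₁ : ∀ s, wX s ≤ 1)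
    {s44 : ℝ} (hs440 : 0 < s44) (hs441 : s44 < 1) (hw1344 : 0 < w13 s44) (hwX44 : 0 < wX s44)
    (bH13 : ∀ x : MemberY d ℓ hd hL b₀ b₁ Mstar, (bg9YR (Matrix (Fin N) (Fin N) ℂ) (specialUnitaryUnits (Fin N)) R₁ R₂ x).Cfg → BlockNorm (toB6 (geo9Y x) 1 (H x)) (XSK (TrIdx N) x.toKIdx → ℝ))
    (hbH13 : ∀ (x : MemberY d ℓ hd hL b₀ b₁ Mstar) (U : (bg9YR (Matrix (Fin N) (Fin N) ℂ) (specialUnitaryUnits (Fin N)) R₁ R₂ x).Cfg), bH13 x U =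
      letI : Fintype (geo9K x.toKIdx).Site := (inferInstance : Fintype (geo9Y x).Site);
      bHZPG (κ := TrIdx N) x.toKIdx (trBasis N) (taxiS x.toKIdx (bg9YR (Matrix (Fin N) (Fin N) ℂ) (specialUnitaryUnits (Fin N)) R₁ R₂ x) (fun U => U) U) (R := (1 : ℝ)) (H := H x) w13 hw13₀ hw13₁)
    (hκ13 : ∀ (x : MemberY d ℓ hd hL b₀ b₁ Mstar) (U : (bg9YR (Matrix (Fin N) (Fin N) ℂ) (specialUnitaryUnits (Fin N)) R₁ R₂ x).Cfg), (bH13 x U).κ ≤ 1 + CLip d ℓ)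
    (bXH : ∀ x : MemberY d ℓ hd hL b₀ b₁ Mstar, (bg9YR (Matrix (Fin N) (Fin N) ℂ) (specialUnitaryUnits (Fin N)) R₁ R₂ x).Cfg → BlockNorm (toB6 (geo9Y x) 1 (H x)) (XBK (TrIdx N) x.toKIdx → ℝ))
    (hbXH : ∀ (x : MemberY d ℓ hd hL b₀ b₁ Mstar) (U : (bg9YR (Matrix (Fin N) (Fin N) ℂ) (specialUnitaryUnits (Fin N)) R₁ R₂ x).Cfg), bXH x U =
      letI : Fintype (geo9K x.toKIdx).Site := (inferInstance : Fintype (geo9Y x).Site);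
      bHZKPG (κ := TrIdx N) x.toKIdx (trBasis N) (taxiB x.toKIdx (bg9YR (Matrix (Fin N) (Fin N) ℂ) (specialUnitaryUnits (Fin N)) R₁ R₂ x) (fun U => U) U) (R := (1 : ℝ)) (H := H x) wX hwX₀ hwX₁)
    (bHXA : ∀ x : MemberY d ℓ hd hL b₀ b₁ Mstar, ℝ → BlockNorm (toB6 (geo9Y x) 1 (H x)) (XBK (TrIdx N) x.toKIdx → ℝ))
    (hbHXA : ∀ x : MemberY d ℓ hd hL b₀ b₁ Mstar, bHXA x = fun ε => letI : Fintype (geo9K x.toKIdx).Site := (inferInstance : Fintype (geo9Y x).Site); bHK x.toKIdx (bI x) ε)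
    (bW : ∀ x : MemberY d ℓ hd hL b₀ b₁ Mstar, (bg9YR (Matrix (Fin N) (Fin N) ℂ) (specialUnitaryUnits (Fin N)) R₁ R₂ x).Cfg → ℝ → BlockNorm (toB6 (geo9Y x) 1 (H x)) (XSK (TrIdx N) x.toKIdx → ℝ))
    (𝔬12 : ∀ x : MemberY d ℓ hd hL b₀ b₁ Mstar, B9Thm312Whole.Ops (geo9Y x) (bg9YR (Matrix (Fin N) (Fin N) ℂ) (specialUnitaryUnits (Fin N)) R₁ R₂ x) (XBK (TrIdx N) x.toKIdx) (XBK (TrIdx N) x.toKIdx) (XHK (TrIdx N) x.toKIdx) (XSK (TrIdx N) x.toKIdx))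
    (hblk12 : ∀ x : MemberY d ℓ hd hL b₀ b₁ Mstar, (𝔬12 x).blk = blkBK x.toKIdx (bI x))
    (hblkW12 : ∀ x : MemberY d ℓ hd hL b₀ b₁ Mstar, (𝔬12 x).blkW = blkSK x.toKIdx (sIK x.toKIdx (bI x)))
    (Δ2 : ∀ x : MemberY d ℓ hd hL b₀ b₁ Mstar, BondOpY (Matrix (Fin N) (Fin N) ℂ) x.toKIdx)
    (hTpico12 : ∀ (x : MemberY d ℓ hd hL b₀ b₁ Mstar) (U : (bg9YR (Matrix (Fin N) (Fin N) ℂ) (specialUnitaryUnits (Fin N)) R₁ R₂ x).Cfg), (𝔬12 x).Tpi U = TpicoK x.toKIdx (trBasis N) (bg9YR (Matrix (Fin N) (Fin N) ℂ) (specialUnitaryUnits (Fin N)) R₁ R₂ x) (fun U => U) (parT x.toKIdx) (GpPhysY x.toKIdx (parT x.toKIdx)) U)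
    (hT2co12 : ∀ (x : MemberY d ℓ hd hL b₀ b₁ Mstar) (U : (bg9YR (Matrix (Fin N) (Fin N) ℂ) (specialUnitaryUnits (Fin N)) R₁ R₂ x).Cfg) , (𝔬12 x).T2 U = T2coK x.toKIdx (trBasis N) (bg9YR (Matrix (Fin N) (Fin N) ℂ) (specialUnitaryUnits (Fin N)) R₁ R₂ x) (fun U => U) (parT x.toKIdx) (GpPhysY x.toKIdx (parT x.toKIdx)) (Δ2 x) U)
    (hDvco12 : ∀ (x : MemberY d ℓ hd hL b₀ b₁ Mstar) (U : (bg9YR (Matrix (Fin N) (Fin N) ℂ) (specialUnitaryUnits (Fin N)) R₁ R₂ x).Cfg), (𝔬12 x).Dv U = DvcoKH x.toKIdx (trBasis N) (bg9YR (Matrix (Fin N) (Fin N) ℂ) (specialUnitaryUnits (Fin N)) R₁ R₂ x) (fun U => U) U)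
    (hDvsco12 : ∀ (x : MemberY d ℓ hd hL b₀ b₁ Mstar) (U : (bg9YR (Matrix (Fin N) (Fin N) ℂ) (specialUnitaryUnits (Fin N)) R₁ R₂ x).Cfg), (𝔬12 x).Dvstar U = DvscoKH x.toKIdx (trBasis N) (bg9YR (Matrix (Fin N) (Fin N) ℂ) (specialUnitaryUnits (Fin N)) R₁ R₂ x) (fun U => U) U)
    (𝔭A : ∀ x : MemberY d ℓ hd hL b₀ b₁ Mstar, HolderProbes (geo9Y x) (bg9YR (Matrix (Fin N) (Fin N) ℂ) (specialUnitaryUnits (Fin N)) R₁ R₂ x) (XBK (TrIdx N) x.toKIdx) (XBK (TrIdx N) x.toKIdx) (PK (FBondY x.toKIdx) (Fin (d + 1)) (TrIdx N)) (PK (FBondY x.toKIdx) (Fin (d + 1)) (TrIdx N)))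
    {parB : ∀ x : MemberY d ℓ hd hL b₀ b₁ Mstar, BondParY (Matrix (Fin N) (Fin N) ℂ) x.toKIdx}
    (hparB : ∀ x : MemberY d ℓ hd hL b₀ b₁ Mstar, parB x = parBY x.toKIdx)
    (h𝔭A : ∀ x : MemberY d ℓ hd hL b₀ b₁ Mstar, 𝔭A x = holderProbesKA x.toKIdx (trBasis N) (bg9YR (Matrix (Fin N) (Fin N) ℂ) (specialUnitaryUnits (Fin N)) R₁ R₂ x) (fun U => U) (parB x) (bI x))
    (Dd Dsd : ∀ x : MemberY d ℓ hd hL b₀ b₁ Mstar, (bg9YR (Matrix (Fin N) (Fin N) ℂ) (specialUnitaryUnits (Fin N)) R₁ R₂ x).Cfg → Fin (d + 1) → Module.End ℝ (XBK (TrIdx N) x.toKIdx → ℝ))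
    (hDd : ∀ (x : MemberY d ℓ hd hL b₀ b₁ Mstar) (U : (bg9YR (Matrix (Fin N) (Fin N) ℂ) (specialUnitaryUnits (Fin N)) R₁ R₂ x).Cfg), Dd x U = fun ν => coordOpK (trBasis N) (fun _ : Fin (d + 1) => cdBₗ x.toKIdx U ν))
    {Gp : ∀ x : MemberY d ℓ hd hL b₀ b₁ Mstar, SiteOpY (Matrix (Fin N) (Fin N) ℂ) x.toKIdx}
    (hGp : ∀ x : MemberY d ℓ hd hL b₀ b₁ Mstar, Gp x = GpY x.toKIdx (parT x.toKIdx))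
    {parS : ∀ x : MemberY d ℓ hd hL b₀ b₁ Mstar, SiteParY (Matrix (Fin N) (Fin N) ℂ) x.toKIdx}
    (hparS : ∀ x : MemberY d ℓ hd hL b₀ b₁ Mstar, parS x = parT x.toKIdx)
    -- letters of the input facts (implicit, read off the facts) and the two target rates
    {B₀ δ₀ CP δ49 tJ δB B43 δ43 tA δT θ₂ δ₂ B44 δ44 B12₃ δ12₃ Bx13₀ B12₀ δ12₀ B₀G δ₀G BHG B₃ δ₃ δK δP CW : ℝ} {Bx13 Bh12 Bi BhG Bd BhD BdX : ℝ → ℝ}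
    (hB₀ : 0 ≤ B₀) (hCP : 0 ≤ CP) (htJ : 0 ≤ tJ) (hB43 : 0 ≤ B43) (htA : 0 ≤ tA) (hθ₂ : 0 ≤ θ₂) (hB44 : 0 ≤ B44) (hB12₃ : 0 ≤ B12₃) (hBx13 : ∀ β, 0 ≤ β → β < 1 → 0 ≤ Bx13 β) (hBx13₀ : 0 ≤ Bx13₀)
    (hwBx13 : ∀ s, 0 < s → s < 1 → wX s * Bx13 s ≤ Bx13₀) (hB12₀ : 0 ≤ B12₀) (hBh12 : ∀ β, 0 ≤ β → β < 1 → 0 ≤ Bh12 β) (hBi : ∀ ε, 0 < ε → ε ≤ 1 → 0 ≤ Bi ε) (hB₀G : 0 ≤ B₀G) (hBhG : ∀ s, 0 < s → s < 1 → 0 ≤ BhG s)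
    (hBHG : 0 ≤ BHG) (hwBhG : ∀ s, 0 < s → s < 1 → wX s * BhG s ≤ BHG) (hBd : ∀ ε, 0 < ε → 0 ≤ Bd ε) (hCW : 0 ≤ CW) (hB₃ : 0 ≤ B₃) (hBhD : ∀ β, 0 ≤ β → β < 1 → 0 ≤ BhD β) (hBdX : ∀ β, 0 ≤ β → β < 1 → 0 ≤ BdX β)
    -- the rate budget: the step∕pair rate δK and the producer∕reading rate δP against the input rates (σ = the row-sum margin, τ = the (Lʲη)-weight loss)
    (hδK : 0 ≤ δK) (hr0 : δK + 3 * σ + 4 * τ ≤ δ₀) (hr49 : δK + 3 * σ + 4 * τ ≤ δ49) (hr2 : δK + 3 * σ + 4 * τ ≤ δ₂) (hr44 : δK + 3 * σ + 5 * τ ≤ δ44) (hrB : δK + 3 * σ + 4 * τ ≤ δB)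
    (hr43 : δK + 2 * σ + τ ≤ δ43) (hrT : δK + τ + σ ≤ δT) (hK3d : δK + τ + σ ≤ δ₃) (hKP : δK + τ + σ ≤ δP)
    (hP0 : δP + 2 * τ ≤ δ12₀) (hP3 : δP + σ + 2 * τ ≤ δ12₃) (hPG : δP + τ ≤ δ₀G)
    -- the input facts (all displayed hypotheses of the certificate of record or outputs of its G₀ layer), member-uniform above (M₀, a₀)
    (h31 : ∀ x : MemberY d ℓ hd hL b₀ b₁ Mstar, M₀ ≤ (geo9Y x).M → ∀ α₀ : ℝ, 0 < α₀ → (geo9Y x).M * α₀ ≤ a₀ → ∀ U : (bg9YR (Matrix (Fin N) (Fin N) ℂ) (specialUnitaryUnits (Fin N)) R₁ R₂ x).Cfg, (bg9YR (Matrix (Fin N) (Fin N) ℂ) (specialUnitaryUnits (Fin N)) R₁ R₂ x).Reg335 c α₀ U →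
      Thm31GpMaj (g := geo9Y x) (blkSK x.toKIdx (sIK x.toKIdx (bI x))) (blkBK x.toKIdx (bI x))
        (GcoS x.toKIdx (trBasis N) (bg9YR (Matrix (Fin N) (Fin N) ℂ) (specialUnitaryUnits (Fin N)) R₁ R₂ x) (fun U => U) (Gp x) U)
        (DvcoKH x.toKIdx (trBasis N) (bg9YR (Matrix (Fin N) (Fin N) ℂ) (specialUnitaryUnits (Fin N)) R₁ R₂ x) (fun U => U) U) (DvscoKH x.toKIdx (trBasis N) (bg9YR (Matrix (Fin N) (Fin N) ℂ) (specialUnitaryUnits (Fin N)) R₁ R₂ x) (fun U => U) U) 1 (H x) B₀ δ₀)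
    (h49 : ∀ j : J, M₀ ≤ (geo9Y (f j)).M → ∀ α₀ : ℝ, 0 < α₀ → (geo9Y (f j)).M * α₀ ≤ a₀ → ∀ U : (bg9YR (Matrix (Fin N) (Fin N) ℂ) (specialUnitaryUnits (Fin N)) R₁ R₂ (f j)).Cfg, (bg9YR (Matrix (Fin N) (Fin N) ℂ) (specialUnitaryUnits (Fin N)) R₁ R₂ (f j)).Reg335 c α₀ U →
      Proj349Maj (g := geo9Y (f j)) (blkSK (f j).toKIdx (sIK (f j).toKIdx (bI (f j)))) (blkBK (f j).toKIdx (bI (f j)))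
        (PcoK (f j).toKIdx (trBasis N) (bg9YR (Matrix (Fin N) (Fin N) ℂ) (specialUnitaryUnits (Fin N)) R₁ R₂ (f j)) (fun U => U) (parS (f j)) (Gp (f j)) U)
        (DvcoKH (f j).toKIdx (trBasis N) (bg9YR (Matrix (Fin N) (Fin N) ℂ) (specialUnitaryUnits (Fin N)) R₁ R₂ (f j)) (fun U => U) U) (DvscoKH (f j).toKIdx (trBasis N) (bg9YR (Matrix (Fin N) (Fin N) ℂ) (specialUnitaryUnits (Fin N)) R₁ R₂ (f j)) (fun U => U) U) 1 (H (f j)) CP δ49)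
    (h43 : ∀ x : MemberY d ℓ hd hL b₀ b₁ Mstar, letI : Fintype (geo9K x.toKIdx).Site := (inferInstance : Fintype (geo9Y x).Site); M₀ ≤ (geo9Y x).M → ∀ α₀ : ℝ, 0 < α₀ → (geo9Y x).M * α₀ ≤ a₀ → ∀ U : (bg9YR (Matrix (Fin N) (Fin N) ℂ) (specialUnitaryUnits (Fin N)) R₁ R₂ x).Cfg, (bg9YR (Matrix (Fin N) (Fin N) ℂ) (specialUnitaryUnits (Fin N)) R₁ R₂ x).Reg335 c α₀ U →
      (bg9YR (Matrix (Fin N) (Fin N) ℂ) (specialUnitaryUnits (Fin N)) R₁ R₂ x).Reg336 c α₀ U →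
        HasMaj (cNorm 1 (H x) (𝔬12 x).blk (fun y => (geo9Y_len_pos x y).le) 0) (bH13 x U)
          (GcoS x.toKIdx (trBasis N) (bg9YR (Matrix (Fin N) (Fin N) ℂ) (specialUnitaryUnits (Fin N)) R₁ R₂ x) (fun U => U) (GpY x.toKIdx (parT x.toKIdx)) U ∘ₗ DvscoKH x.toKIdx (trBasis N) (bg9YR (Matrix (Fin N) (Fin N) ℂ) (specialUnitaryUnits (Fin N)) R₁ R₂ x) (fun U => U) U)
          (fun a a' => B43 * Real.exp (-(δ43 * (geo9Y x).dist a a'))))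
    (h44G : ∀ x : MemberY d ℓ hd hL b₀ b₁ Mstar, letI : Fintype (geo9K x.toKIdx).Site := (inferInstance : Fintype (geo9Y x).Site); M₀ ≤ (geo9Y x).M → ∀ α₀ : ℝ, 0 < α₀ → (geo9Y x).M * α₀ ≤ a₀ → ∀ U : (bg9YR (Matrix (Fin N) (Fin N) ℂ) (specialUnitaryUnits (Fin N)) R₁ R₂ x).Cfg, (bg9YR (Matrix (Fin N) (Fin N) ℂ) (specialUnitaryUnits (Fin N)) R₁ R₂ x).Reg335 c α₀ U → (bg9YR (Matrix (Fin N) (Fin N) ℂ) (specialUnitaryUnits (Fin N)) R₁ R₂ x).Reg336 c α₀ U →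
      HasMaj (bHZKP (κ := TrIdx N) x.toKIdx (trBasis N) (taxiB x.toKIdx (bg9YR (Matrix (Fin N) (Fin N) ℂ) (specialUnitaryUnits (Fin N)) R₁ R₂ x) (fun U => U) U) (R := (1 : ℝ)) (H := H x) hs440.le hs441.le) (cNorm 1 (H x) (𝔬12 x).blk (fun y => (geo9Y_len_pos x y).le) 1)
        ((𝔬12 x).Dv U ∘ₗ GcoS x.toKIdx (trBasis N) (bg9YR (Matrix (Fin N) (Fin N) ℂ) (specialUnitaryUnits (Fin N)) R₁ R₂ x) (fun U => U) (GpY x.toKIdx (parT x.toKIdx)) U ∘ₗ (𝔬12 x).Dvstar U) (fun a b => B44 * Real.exp (-(δ44 * (geo9Y x).dist a b))))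
    (hD2 : ∀ j : J, M₀ ≤ (geo9Y (f j)).M → ∀ α₀ : ℝ, 0 < α₀ → (geo9Y (f j)).M * α₀ ≤ a₀ → ∀ U : (bg9YR (Matrix (Fin N) (Fin N) ℂ) (specialUnitaryUnits (Fin N)) R₁ R₂ (f j)).Cfg, (bg9YR (Matrix (Fin N) (Fin N) ℂ) (specialUnitaryUnits (Fin N)) R₁ R₂ (f j)).Reg335 c α₀ U →
      (bg9YR (Matrix (Fin N) (Fin N) ℂ) (specialUnitaryUnits (Fin N)) R₁ R₂ (f j)).Reg336 c α₀ U → HasMajorant (g := toB6 (geo9Y (f j)) 1 (H (f j))) (𝔬12 (f j)).blk (D2coK (f j).toKIdx (trBasis N) (bg9YR (Matrix (Fin N) (Fin N) ℂ) (specialUnitaryUnits (Fin N)) R₁ R₂ (f j)) (fun U => U) (Δ2 (f j)) U) (fun (a b : (geo9Y (f j)).Site) => θ₂ * ((geo9Y (f j)).M * α₀) * ((geo9Y (f j)).len a ^ 2)⁻¹ * Real.exp (-(δ₂ * (geo9Y (f j)).dist a b))))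
    (hta : ∀ j : J, M₀ ≤ (geo9Y (f j)).M → ∀ α₀ : ℝ, 0 < α₀ → (geo9Y (f j)).M * α₀ ≤ a₀ → ∀ U : (bg9YR (Matrix (Fin N) (Fin N) ℂ) (specialUnitaryUnits (Fin N)) R₁ R₂ (f j)).Cfg, (bg9YR (Matrix (Fin N) (Fin N) ℂ) (specialUnitaryUnits (Fin N)) R₁ R₂ (f j)).Reg335 c α₀ U →
      (bg9YR (Matrix (Fin N) (Fin N) ℂ) (specialUnitaryUnits (Fin N)) R₁ R₂ (f j)).Reg336 c α₀ U → HasMaj (cNorm 1 (H (f j)) (𝔬12 (f j)).blk (fun y => (geo9Y_len_pos (f j) y).le) 2) (cNorm 1 (H (f j)) (𝔬12 (f j)).blk (fun y => (geo9Y_len_pos (f j) y).le) 0) (TaLcoK (f j).toKIdx (trBasis N) (bg9YR (Matrix (Fin N) (Fin N) ℂ) (specialUnitaryUnits (Fin N)) R₁ R₂ (f j)) (fun U => U) (parT (f j).toKIdx) (GpPhysY (f j).toKIdx (parT (f j).toKIdx)) U) (fun a a' => tA * ((geo9Y (f j)).M * α₀) * Real.exp (-(δT * (geo9Y (f j)).dist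 a a'))))
    (hBJ : ∀ x : MemberY d ℓ hd hL b₀ b₁ Mstar, M₀ ≤ (geo9Y x).M → ∀ α₀ : ℝ, 0 < α₀ → (geo9Y x).M * α₀ ≤ a₀ → ∀ U : (bg9YR (Matrix (Fin N) (Fin N) ℂ) (specialUnitaryUnits (Fin N)) R₁ R₂ x).Cfg, (bg9YR (Matrix (Fin N) (Fin N) ℂ) (specialUnitaryUnits (Fin N)) R₁ R₂ x).Reg335 c α₀ U →
      (bg9YR (Matrix (Fin N) (Fin N) ℂ) (specialUnitaryUnits (Fin N)) R₁ R₂ x).Reg336 c α₀ U → CurrentMaj (𝔬12 x).blkW (𝔬12 x).blk (BcoKH x.toKIdx (trBasis N) (bg9YR (Matrix (Fin N) (Fin N) ℂ) (specialUnitaryUnits (Fin N)) R₁ R₂ x) (fun U => U) U)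
        (BdcoKH x.toKIdx (trBasis N) (bg9YR (Matrix (Fin N) (Fin N) ℂ) (specialUnitaryUnits (Fin N)) R₁ R₂ x) (fun U => U) U) 1 (H x) (tJ * ((geo9Y x).M * α₀)) δB)
    (hZ81 : ∀ x : MemberY d ℓ hd hL b₀ b₁ Mstar, M₀ ≤ (geo9Y x).M → ∀ α₀ : ℝ, 0 < α₀ → (geo9Y x).M * α₀ ≤ a₀ → ∀ U : (bg9YR (Matrix (Fin N) (Fin N) ℂ) (specialUnitaryUnits (Fin N)) R₁ R₂ x).Cfg, (bg9YR (Matrix (Fin N) (Fin N) ℂ) (specialUnitaryUnits (Fin N)) R₁ R₂ x).Reg335 c α₀ U → (bg9YR (Matrix (Fin N) (Fin N) ℂ) (specialUnitaryUnits (Fin N)) R₁ R₂ x).Reg336 c α₀ U →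
      HasMaj (cNorm 1 (H x) (𝔬12 x).blkW (fun y => (geo9Y_len_pos x y).le) 1) (cNorm 1 (H x) (𝔬12 x).blk (fun y => (geo9Y_len_pos x y).le) 2) ((𝔬12 x).G0 U ∘ₗ (𝔬12 x).Dv U)
        (fun a b => B12₃ * Real.exp (-(δ12₃ * (geo9Y x).dist a b))))
    (hpXDv : ∀ x : MemberY d ℓ hd hL b₀ b₁ Mstar, M₀ ≤ (geo9Y x).M → ∀ α₀ : ℝ, 0 < α₀ → (geo9Y x).M * α₀ ≤ a₀ → ∀ U : (bg9YR (Matrix (Fin N) (Fin N) ℂ) (specialUnitaryUnits (Fin N)) R₁ R₂ x).Cfg, (bg9YR (Matrix (Fin N) (Fin N) ℂ) (specialUnitaryUnits (Fin N)) R₁ R₂ x).Reg335 c α₀ U → (bg9YR (Matrix (Fin N) (Fin N) ℂ) (specialUnitaryUnits (Fin N)) R₁ R₂ x).Reg336 c α₀ U → ∀ β : ℝ, 0 ≤ β → β < 1 →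
      HasMaj (cNormR 1 (H x) (𝔬12 x).blkW (fun y => (geo9Y_len_pos x y).le) 0) (cNormR 1 (H x) (𝔭A x).blkPX (fun y => (geo9Y_len_pos x y).le) (β - 1))
        (((𝔭A x).ΦX U β ∘ₗ (𝔬12 x).G0 U) ∘ₗ (𝔬12 x).Dv U) (fun a b => Bx13 β * Real.exp (-(δ12₃ * (geo9Y x).dist a b))))
    (he0 : ∀ x : MemberY d ℓ hd hL b₀ b₁ Mstar, M₀ ≤ (geo9Y x).M → ∀ α₀ : ℝ, 0 < α₀ → (geo9Y x).M * α₀ ≤ a₀ → ∀ U : (bg9YR (Matrix (Fin N) (Fin N) ℂ) (specialUnitaryUnits (Fin N)) R₁ R₂ x).Cfg, (bg9YR (Matrix (Fin N) (Fin N) ℂ) (specialUnitaryUnits (Fin N)) R₁ R₂ x).Reg335 c α₀ U → (bg9YR (Matrix (Fin N) (Fin N) ℂ) (specialUnitaryUnits (Fin N)) R₁ R₂ x).Reg336 c α₀ U →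
      HasMajorant (g := toB6 (geo9Y x) 1 (H x)) (𝔬12 x).blk ((𝔬12 x).G0 U) (fun (a b : (geo9Y x).Site) => B12₀ * (geo9Y x).len a ^ 2 * Real.exp (-(δ12₀ * (geo9Y x).dist a b))))
    (he1d : ∀ x : MemberY d ℓ hd hL b₀ b₁ Mstar, M₀ ≤ (geo9Y x).M → ∀ α₀ : ℝ, 0 < α₀ → (geo9Y x).M * α₀ ≤ a₀ → ∀ U : (bg9YR (Matrix (Fin N) (Fin N) ℂ) (specialUnitaryUnits (Fin N)) R₁ R₂ x).Cfg, (bg9YR (Matrix (Fin N) (Fin N) ℂ) (specialUnitaryUnits (Fin N)) R₁ R₂ x).Reg335 c α₀ U → (bg9YR (Matrix (Fin N) (Fin N) ℂ) (specialUnitaryUnits (Fin N)) R₁ R₂ x).Reg336 c α₀ U → ∀ μ : Fin (d + 1),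
      HasMajorantHom (g := toB6 (geo9Y x) 1 (H x)) (𝔬12 x).blk (𝔬12 x).blk (Dd x U μ ∘ₗ (𝔬12 x).G0 U)
        (fun (a b : (geo9Y x).Site) => B12₀ * (geo9Y x).len a * Real.exp (-(δ12₀ * (geo9Y x).dist a b))))
    (he2 : ∀ x : MemberY d ℓ hd hL b₀ b₁ Mstar, M₀ ≤ (geo9Y x).M → ∀ α₀ : ℝ, 0 < α₀ → (geo9Y x).M * α₀ ≤ a₀ → ∀ U : (bg9YR (Matrix (Fin N) (Fin N) ℂ) (specialUnitaryUnits (Fin N)) R₁ R₂ x).Cfg, (bg9YR (Matrix (Fin N) (Fin N) ℂ) (specialUnitaryUnits (Fin N)) R₁ R₂ x).Reg335 c α₀ U → (bg9YR (Matrix (Fin N) (Fin N) ℂ) (specialUnitaryUnits (Fin N)) R₁ R₂ x).Reg336 c α₀ U →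
      HasMajorantHom (g := toB6 (geo9Y x) 1 (H x)) (𝔬12 x).blkY (𝔬12 x).blk ((𝔬12 x).G0 U ∘ₗ (𝔬12 x).Dstar U) (fun a b => B₀G * (geo9Y x).len a * Real.exp (-(δ₀G * (geo9Y x).dist a b))))
    (h43RG : ∀ x : MemberY d ℓ hd hL b₀ b₁ Mstar, M₀ ≤ (geo9Y x).M → ∀ α₀ : ℝ, 0 < α₀ → (geo9Y x).M * α₀ ≤ a₀ → ∀ U : (bg9YR (Matrix (Fin N) (Fin N) ℂ) (specialUnitaryUnits (Fin N)) R₁ R₂ x).Cfg, (bg9YR (Matrix (Fin N) (Fin N) ℂ) (specialUnitaryUnits (Fin N)) R₁ R₂ x).Reg335 c α₀ U → (bg9YR (Matrix (Fin N) (Fin N) ℂ) (specialUnitaryUnits (Fin N)) R₁ R₂ x).Reg336 c α₀ U →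
      ∀ s' : ℝ, 0 < s' → s' < 1 → HasMajorantHom (g := toB6 (geo9Y x) 1 (H x)) (𝔬12 x).blkY (𝔭A x).blkPX ((𝔭A x).ΦX U s' ∘ₗ ((𝔬12 x).G0 U ∘ₗ (𝔬12 x).Dstar U)) (fun (a b : (geo9Y x).Site) => BhG s' * (geo9Y x).len a ^ (1 - s') * Real.exp (-(δ₀G * (geo9Y x).dist a b))))
    (hgQs1 : ∀ x : MemberY d ℓ hd hL b₀ b₁ Mstar, M₀ ≤ (geo9Y x).M → ∀ α₀ : ℝ, 0 < α₀ → (geo9Y x).M * α₀ ≤ a₀ → ∀ U : (bg9YR (Matrix (Fin N) (Fin N) ℂ) (specialUnitaryUnits (Fin N)) R₁ R₂ x).Cfg, (bg9YR (Matrix (Fin N) (Fin N) ℂ) (specialUnitaryUnits (Fin N)) R₁ R₂ x).Reg335 c α₀ U → (bg9YR (Matrix (Fin N) (Fin N) ℂ) (specialUnitaryUnits (Fin N)) R₁ R₂ x).Reg336 c α₀ U →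
      HasMaj (weightNorm (BlockNorm.ofBlocks (toB6 (geo9Y x) 1 (H x)) (𝔬12 x).blkZ) (fun y => (geo9Y x).len y * (fun y => ((((ℓ + 1 : ℕ) : ℝ) ^ (d + 1)) ^ lvl x.hN x.D x.hk y)⁻¹) y) (fun y => (mul_pos (geo9Y_len_pos x y) (plateau_pos x.toKIdx y)).le)) (cNorm 1 (H x) (𝔬12 x).blk (fun y => (geo9Y_len_pos x y).le) 1) ((𝔬12 x).G0 U ∘ₗ (𝔬12 x).Qstar U) (fun a b => B12₃ * Real.exp (-(δ12₃ * (geo9Y x).dist a b))))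
    (hpXQs : ∀ x : MemberY d ℓ hd hL b₀ b₁ Mstar, M₀ ≤ (geo9Y x).M → ∀ α₀ : ℝ, 0 < α₀ → (geo9Y x).M * α₀ ≤ a₀ → ∀ U : (bg9YR (Matrix (Fin N) (Fin N) ℂ) (specialUnitaryUnits (Fin N)) R₁ R₂ x).Cfg, (bg9YR (Matrix (Fin N) (Fin N) ℂ) (specialUnitaryUnits (Fin N)) R₁ R₂ x).Reg335 c α₀ U → (bg9YR (Matrix (Fin N) (Fin N) ℂ) (specialUnitaryUnits (Fin N)) R₁ R₂ x).Reg336 c α₀ U → ∀ β : ℝ, 0 ≤ β → β < 1 →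
      HasMaj (weightNorm (BlockNorm.ofBlocks (toB6 (geo9Y x) 1 (H x)) (𝔬12 x).blkZ) (fun y => (geo9Y x).len y * (fun y => ((((ℓ + 1 : ℕ) : ℝ) ^ (d + 1)) ^ lvl x.hN x.D x.hk y)⁻¹) y) (fun y => (mul_pos (geo9Y_len_pos x y) (plateau_pos x.toKIdx y)).le)) (cNormR 1 (H x) (𝔭A x).blkPX (fun y => (geo9Y_len_pos x y).le) (β - 1)) (((𝔭A x).ΦX U β ∘ₗ (𝔬12 x).G0 U) ∘ₗ (𝔬12 x).Qstar U) (fun a b => Bx13 β * Real.exp (-(δ12₃ * (geo9Y x).dist a b))))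
    (hDirR : ∀ x : MemberY d ℓ hd hL b₀ b₁ Mstar, M₀ ≤ (geo9Y x).M → ∀ α₀ : ℝ, 0 < α₀ → (geo9Y x).M * α₀ ≤ a₀ → ∀ U : (bg9YR (Matrix (Fin N) (Fin N) ℂ) (specialUnitaryUnits (Fin N)) R₁ R₂ x).Cfg, (bg9YR (Matrix (Fin N) (Fin N) ℂ) (specialUnitaryUnits (Fin N)) R₁ R₂ x).Reg335 c α₀ U → (bg9YR (Matrix (Fin N) (Fin N) ℂ) (specialUnitaryUnits (Fin N)) R₁ R₂ x).Reg336 c α₀ U →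
      Thm33G0DirR (𝔬12 x) (Dsd x) 1 (H x) B12₀ δ12₀ U)
    (hDir : ∀ x : MemberY d ℓ hd hL b₀ b₁ Mstar, M₀ ≤ (geo9Y x).M → ∀ α₀ : ℝ, 0 < α₀ → (geo9Y x).M * α₀ ≤ a₀ → ∀ U : (bg9YR (Matrix (Fin N) (Fin N) ℂ) (specialUnitaryUnits (Fin N)) R₁ R₂ x).Cfg, (bg9YR (Matrix (Fin N) (Fin N) ℂ) (specialUnitaryUnits (Fin N)) R₁ R₂ x).Reg335 c α₀ U → (bg9YR (Matrix (Fin N) (Fin N) ℂ) (specialUnitaryUnits (Fin N)) R₁ R₂ x).Reg336 c α₀ U →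
      ∀ (q : Fin (d + 1) × Fin (d + 1)) (ε : ℝ), 0 < ε → ε ≤ 1 → HasMaj (bHXA x ε) (BlockNorm.ofBlocks (toB6 (geo9Y x) 1 (H x)) (𝔬12 x).blk) (Dd x U q.1 ∘ₗ ((𝔬12 x).G0 U ∘ₗ Dsd x U q.2))
        (fun (a b : (geo9Y x).Site) => Bi ε * Real.exp (-(δ12₀ * (geo9Y x).dist a b))))
    (hdgDvd : ∀ x : MemberY d ℓ hd hL b₀ b₁ Mstar, M₀ ≤ (geo9Y x).M → ∀ α₀ : ℝ, 0 < α₀ → (geo9Y x).M * α₀ ≤ a₀ → ∀ U : (bg9YR (Matrix (Fin N) (Fin N) ℂ) (specialUnitaryUnits (Fin N)) R₁ R₂ x).Cfg, (bg9YR (Matrix (Fin N) (Fin N) ℂ) (specialUnitaryUnits (Fin N)) R₁ R₂ x).Reg335 c α₀ U → (bg9YR (Matrix (Fin N) (Fin N) ℂ) (specialUnitaryUnits (Fin N)) R₁ R₂ x).Reg336 c α₀ U →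
      ∀ (ν : Fin (d + 1)) (ε : ℝ), 0 < ε →
        HasMaj (bW x U ε) (BlockNorm.ofBlocks (toB6 (geo9Y x) 1 (H x)) (𝔬12 x).blk) (Dd x U ν ∘ₗ ((𝔬12 x).G0 U ∘ₗ (𝔬12 x).Dv U)) (fun (a b : (geo9Y x).Site) => Bd ε * Real.exp (-(δ12₃ * (geo9Y x).dist a b))))
    -- (variant `W`) the site class DOMINATES the block-sup class of the site fields: the source transfer of the z-letters' sup word into `bW x U ε` (class lemma, displayed)
    (htransW : ∀ x : MemberY d ℓ hd hL b₀ b₁ Mstar, M₀ ≤ (geo9Y x).M → ∀ (U : (bg9YR (Matrix (Fin N) (Fin N) ℂ) (specialUnitaryUnits (Fin N)) R₁ R₂ x).Cfg) (ε : ℝ), 0 < ε → ∀ K : ℝ, 0 ≤ K → HasMaj (BlockNorm.ofBlocks (toB6 (geo9Y x) 1 (H x)) (blkSK x.toKIdx (sIK x.toKIdx (bI x)))) (cNormR 1 (H x) (blkBK x.toKIdx (bI x)) (fun y => (geo9Y_len_pos x y).le) (-1)) ((𝔬12 x).G0 U ∘ₗ (𝔬12 x).Dv U) (fun a b => K * Real.exp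 (-((δ12₃ - τ) * (geo9Y x).dist a b))) →
      HasMaj (bW x U ε) (cNormR 1 (H x) (blkBK x.toKIdx (bI x)) (fun y => (geo9Y_len_pos x y).le) (-1)) ((𝔬12 x).G0 U ∘ₗ (𝔬12 x).Dv U) (fun a b => CW * K * Real.exp (-((δ12₃ - τ) * (geo9Y x).dist a b))))
    (he1 : ∀ x : MemberY d ℓ hd hL b₀ b₁ Mstar, M₀ ≤ (geo9Y x).M → ∀ α₀ : ℝ, 0 < α₀ → (geo9Y x).M * α₀ ≤ a₀ → ∀ U : (bg9YR (Matrix (Fin N) (Fin N) ℂ) (specialUnitaryUnits (Fin N)) R₁ R₂ x).Cfg, (bg9YR (Matrix (Fin N) (Fin N) ℂ) (specialUnitaryUnits (Fin N)) R₁ R₂ x).Reg335 c α₀ U → (bg9YR (Matrix (Fin N) (Fin N) ℂ) (specialUnitaryUnits (Fin N)) R₁ R₂ x).Reg336 c α₀ U →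
      HasMajorantHom (g := toB6 (geo9Y x) 1 (H x)) (𝔬12 x).blk (𝔬12 x).blkY ((𝔬12 x).D U ∘ₗ (𝔬12 x).G0 U) (fun (a b : (geo9Y x).Site) => B12₀ * (geo9Y x).len a * Real.exp (-(δ12₀ * (geo9Y x).dist a b))))
    (h43L : ∀ x : MemberY d ℓ hd hL b₀ b₁ Mstar, M₀ ≤ (geo9Y x).M → ∀ α₀ : ℝ, 0 < α₀ → (geo9Y x).M * α₀ ≤ a₀ → ∀ U : (bg9YR (Matrix (Fin N) (Fin N) ℂ) (specialUnitaryUnits (Fin N)) R₁ R₂ x).Cfg, (bg9YR (Matrix (Fin N) (Fin N) ℂ) (specialUnitaryUnits (Fin N)) R₁ R₂ x).Reg335 c α₀ U → (bg9YR (Matrix (Fin N) (Fin N) ℂ) (specialUnitaryUnits (Fin N)) R₁ R₂ x).Reg336 c α₀ U → ∀ β : ℝ, 0 ≤ β → β < 1 →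
      HasMajorantHom (g := toB6 (geo9Y x) 1 (H x)) (𝔬12 x).blk (𝔭A x).blkPY ((𝔭A x).ΦY U β ∘ₗ ((𝔬12 x).D U ∘ₗ (𝔬12 x).G0 U)) (fun (a b : (geo9Y x).Site) => Bh12 β * (geo9Y x).len a ^ (1 - β) * Real.exp (-(δ12₀ * (geo9Y x).dist a b))))
    (h43d : ∀ x : MemberY d ℓ hd hL b₀ b₁ Mstar, M₀ ≤ (geo9Y x).M → ∀ α₀ : ℝ, 0 < α₀ → (geo9Y x).M * α₀ ≤ a₀ → ∀ U : (bg9YR (Matrix (Fin N) (Fin N) ℂ) (specialUnitaryUnits (Fin N)) R₁ R₂ x).Cfg, (bg9YR (Matrix (Fin N) (Fin N) ℂ) (specialUnitaryUnits (Fin N)) R₁ R₂ x).Reg335 c α₀ U → (bg9YR (Matrix (Fin N) (Fin N) ℂ) (specialUnitaryUnits (Fin N)) R₁ R₂ x).Reg336 c α₀ U → ∀ (ν : Fin (d + 1)) (β : ℝ), 0 ≤ β → β < 1 →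
      HasMajorantHom (g := toB6 (geo9Y x) 1 (H x)) (𝔬12 x).blk (𝔭A x).blkPX ((𝔭A x).ΦX U β ∘ₗ (Dd x U ν ∘ₗ (𝔬12 x).G0 U)) (fun (a b : (geo9Y x).Site) => Bh12 β * (geo9Y x).len a ^ (1 - β) * Real.exp (-(δ12₀ * (geo9Y x).dist a b))))
    (hdgDH : ∀ x : MemberY d ℓ hd hL b₀ b₁ Mstar, M₀ ≤ (geo9Y x).M → ∀ α₀ : ℝ, 0 < α₀ → (geo9Y x).M * α₀ ≤ a₀ → ∀ U : (bg9YR (Matrix (Fin N) (Fin N) ℂ) (specialUnitaryUnits (Fin N)) R₁ R₂ x).Cfg, (bg9YR (Matrix (Fin N) (Fin N) ℂ) (specialUnitaryUnits (Fin N)) R₁ R₂ x).Reg335 c α₀ U → (bg9YR (Matrix (Fin N) (Fin N) ℂ) (specialUnitaryUnits (Fin N)) R₁ R₂ x).Reg336 c α₀ U →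
      HasMaj (bH13 x U) (cNorm 1 (H x) (𝔬12 x).blkY (fun y => (geo9Y_len_pos x y).le) 1) ((𝔬12 x).D U ∘ₗ (𝔬12 x).G0 U ∘ₗ (𝔬12 x).Dv U) (fun a a' => B₃ * Real.exp (-(δ₃ * (geo9Y x).dist a a'))))
    (hdgDHd : ∀ x : MemberY d ℓ hd hL b₀ b₁ Mstar, M₀ ≤ (geo9Y x).M → ∀ α₀ : ℝ, 0 < α₀ → (geo9Y x).M * α₀ ≤ a₀ → ∀ U : (bg9YR (Matrix (Fin N) (Fin N) ℂ) (specialUnitaryUnits (Fin N)) R₁ R₂ x).Cfg, (bg9YR (Matrix (Fin N) (Fin N) ℂ) (specialUnitaryUnits (Fin N)) R₁ R₂ x).Reg335 c α₀ U → (bg9YR (Matrix (Fin N) (Fin N) ℂ) (specialUnitaryUnits (Fin N)) R₁ R₂ x).Reg336 c α₀ U → ∀ ν : Fin (d + 1),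
      HasMaj (bH13 x U) (cNorm 1 (H x) (𝔬12 x).blk (fun y => (geo9Y_len_pos x y).le) 1) (Dd x U ν ∘ₗ (𝔬12 x).G0 U ∘ₗ (𝔬12 x).Dv U) (fun a a' => B₃ * Real.exp (-(δ₃ * (geo9Y x).dist a a'))))
    (hYd : ∀ x : MemberY d ℓ hd hL b₀ b₁ Mstar, M₀ ≤ (geo9Y x).M → ∀ α₀ : ℝ, 0 < α₀ → (geo9Y x).M * α₀ ≤ a₀ → ∀ U : (bg9YR (Matrix (Fin N) (Fin N) ℂ) (specialUnitaryUnits (Fin N)) R₁ R₂ x).Cfg, (bg9YR (Matrix (Fin N) (Fin N) ℂ) (specialUnitaryUnits (Fin N)) R₁ R₂ x).Reg335 c α₀ U → (bg9YR (Matrix (Fin N) (Fin N) ℂ) (specialUnitaryUnits (Fin N)) R₁ R₂ x).Reg336 c α₀ U → ∀ β : ℝ, 0 ≤ β → β < 1 →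
      HasMaj (bH13 x U) (cNormR 1 (H x) (𝔭A x).blkPY (fun y => (geo9Y_len_pos x y).le) (β - 1)) (((𝔭A x).ΦY U β ∘ₗ (𝔬12 x).D U ∘ₗ (𝔬12 x).G0 U) ∘ₗ (𝔬12 x).Dv U) (fun a a' => BhD β * Real.exp (-(δ₃ * (geo9Y x).dist a a'))))
    (hXd : ∀ x : MemberY d ℓ hd hL b₀ b₁ Mstar, M₀ ≤ (geo9Y x).M → ∀ α₀ : ℝ, 0 < α₀ → (geo9Y x).M * α₀ ≤ a₀ → ∀ U : (bg9YR (Matrix (Fin N) (Fin N) ℂ) (specialUnitaryUnits (Fin N)) R₁ R₂ x).Cfg, (bg9YR (Matrix (Fin N) (Fin N) ℂ) (specialUnitaryUnits (Fin N)) R₁ R₂ x).Reg335 c α₀ U → (bg9YR (Matrix (Fin N) (Fin N) ℂ) (specialUnitaryUnits (Fin N)) R₁ R₂ x).Reg336 c α₀ U → ∀ (ν : Fin (d + 1)) (β : ℝ), 0 ≤ β → β < 1 →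
      HasMaj (bH13 x U) (cNormR 1 (H x) (𝔭A x).blkPX (fun y => (geo9Y_len_pos x y).le) (β - 1)) (((𝔭A x).ΦX U β ∘ₗ Dd x U ν ∘ₗ (𝔬12 x).G0 U) ∘ₗ (𝔬12 x).Dv U) (fun a a' => BdX β * Real.exp (-(δ₃ * (geo9Y x).dist a a')))) :
    ∃ (MT θS θD A₀S AW AQ AD AQ1 CR : ℝ) (θH AI AV : ℝ → ℝ), 0 ≤ θS ∧ 0 ≤ θD ∧ (∀ β, 0 ≤ β → β < 1 → 0 ≤ θH β) ∧ 0 ≤ A₀S ∧ 0 ≤ AW ∧ 0 ≤ AQ ∧ 0 ≤ AD ∧ 0 ≤ AQ1 ∧ 0 ≤ CR ∧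
      (∀ ε, 0 < ε → 0 ≤ AI ε) ∧ (∀ ε, 0 < ε → 0 ≤ AV ε) ∧
      ∀ j : J, MT ≤ (geo9Y (f j)).M → ∀ α₀ : ℝ, 0 < α₀ → (geo9Y (f j)).M * α₀ ≤ a₀ → ∀ U : (bg9YR (Matrix (Fin N) (Fin N) ℂ) (specialUnitaryUnits (Fin N)) R₁ R₂ (f j)).Cfg, (bg9YR (Matrix (Fin N) (Fin N) ℂ) (specialUnitaryUnits (Fin N)) R₁ R₂ (f j)).Reg335 c α₀ U →
      (bg9YR (Matrix (Fin N) (Fin N) ℂ) (specialUnitaryUnits (Fin N)) R₁ R₂ (f j)).Reg336 c α₀ U →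
        (StepS (𝔬12 (f j)) (weightNorm (bXH (f j) U) (rwt (geo9Y (f j)) (-1)) (rwt_nonneg (fun y => (geo9Y_len_pos (f j) y).le) (-1))) (θS * ((geo9Y (f j)).M * α₀)) δK U ∧
          (HasMaj (weightNorm (bXH (f j) U) (rwt (geo9Y (f j)) (-1)) (rwt_nonneg (fun y => (geo9Y_len_pos (f j) y).le) (-1))) (cNorm 1 (H (f j)) (𝔬12 (f j)).blkY (fun y => (geo9Y_len_pos (f j) y).le) 1) ((𝔬12 (f j)).D U ∘ₗ (𝔬12 (f j)).G0 U ∘ₗ (𝔬12 (f j)).Tpi U) (fun a b => θD * ((geo9Y (f j)).M * α₀) * Real.exp (-(δK * (geo9Y (f j)).dist a b))) ∧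
            HasMaj (weightNorm (bXH (f j) U) (rwt (geo9Y (f j)) (-1)) (rwt_nonneg (fun y => (geo9Y_len_pos (f j) y).le) (-1))) (cNorm 1 (H (f j)) (𝔬12 (f j)).blkY (fun y => (geo9Y_len_pos (f j) y).le) 1) ((𝔬12 (f j)).D U ∘ₗ (𝔬12 (f j)).G0 U ∘ₗ ((𝔬12 (f j)).Tpi U + (𝔬12 (f j)).T2 U)) (fun a b => θD * ((geo9Y (f j)).M * α₀) * Real.exp (-(δK * (geo9Y (f j)).dist a b)))) ∧
          (∀ β : ℝ, 0 ≤ β → β < 1 →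
            HasMaj (weightNorm (bXH (f j) U) (rwt (geo9Y (f j)) (-1)) (rwt_nonneg (fun y => (geo9Y_len_pos (f j) y).le) (-1))) (cNormR 1 (H (f j)) (𝔭A (f j)).blkPY (fun y => (geo9Y_len_pos (f j) y).le) (β - 1)) (((𝔭A (f j)).ΦY U β ∘ₗ (𝔬12 (f j)).D U ∘ₗ (𝔬12 (f j)).G0 U) ∘ₗ (𝔬12 (f j)).Tpi U) (fun a b => θH β * ((geo9Y (f j)).M * α₀) * Real.exp (-(δK * (geo9Y (f j)).dist a b))) ∧
            HasMaj (weightNorm (bXH (f j) U) (rwt (geo9Y (f j)) (-1)) (rwt_nonneg (fun y => (geo9Y_len_pos (f j) y).le) (-1))) (cNormR 1 (H (f j)) (𝔭A (f j)).blkPY (fun y => (geo9Y_len_pos (f j) y).le) (β - 1)) (((𝔭A (f j)).ΦY U β ∘ₗ (𝔬12 (f j)).D U ∘ₗ (𝔬12 (f j)).G0 U) ∘ₗ ((𝔬12 (f j)).Tpi U + (𝔬12 (f j)).T2 U)) (fun a b => θH β * ((geo9Y (f j)).M * α₀) * Real.exp (-(δK * (geo9Y (f j)).dist a b)))) ∧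
          HasMaj (cNorm 1 (H (f j)) (𝔬12 (f j)).blk (fun y => (geo9Y_len_pos (f j) y).le) 0) (weightNorm (bXH (f j) U) (rwt (geo9Y (f j)) (-1)) (rwt_nonneg (fun y => (geo9Y_len_pos (f j) y).le) (-1))) ((𝔬12 (f j)).G0 U) (fun a b => A₀S * Real.exp (-(δP * (geo9Y (f j)).dist a b))) ∧
          HasMaj (weightNorm (BlockNorm.ofBlocks (toB6 (geo9Y (f j)) 1 (H (f j))) (𝔬12 (f j)).blkZ) (fun y => ((((ℓ + 1 : ℕ) : ℝ) ^ (d + 1)) ^ lvl (f j).hN (f j).D (f j).hk y)⁻¹) (fun y => (plateau_pos (f j).toKIdx y).le)) (weightNorm (bXH (f j) U) (rwt (geo9Y (f j)) (-1)) (rwt_nonneg (fun y => (geo9Y_len_pos (f j) y).le) (-1))) ((𝔬12 (f j)).G0 U ∘ₗ (𝔬12 (f j)).Qstar U) (fun a b => AQ * Real.exp (-(δP * (geo9Y (f j)).dist a b))) ∧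
          HasMaj (weightNorm (bXH (f j) U) (rwt (geo9Y (f j)) (-1)) (rwt_nonneg (fun y => (geo9Y_len_pos (f j) y).le) (-1))) (cNormR 1 (H (f j)) (𝔬12 (f j)).blk (fun y => (geo9Y_len_pos (f j) y).le) (-2)) LinearMap.id (fun a b => CR * Real.exp (-(δP * (geo9Y (f j)).dist a b))) ∧
          (weightNorm (bXH (f j) U) (rwt (geo9Y (f j)) (-1)) (rwt_nonneg (fun y => (geo9Y_len_pos (f j) y).le) (-1))).κ ≤ (1 + CLip d ℓ) ∧
          (∃ Λ : ℝ, 0 ≤ Λ ∧ ∀ (y : (geo9Y (f j)).Site) (F : XBK (TrIdx N) (f j).toKIdx → ℝ), (weightNorm (bXH (f j) U) (rwt (geo9Y (f j)) (-1)) (rwt_nonneg (fun y => (geo9Y_len_pos (f j) y).le) (-1))).loc y F ≤ Λ * ∑ q : XBK (TrIdx N) (f j).toKIdx, |F q|)) ∧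
        (StepS (𝔬12 (f j)) (bXH (f j) U) (θS * ((geo9Y (f j)).M * α₀)) δK U ∧
          (∀ ν : Fin (d + 1),
            HasMaj (bXH (f j) U) (cNormR 1 (H (f j)) (𝔬12 (f j)).blk (fun y => (geo9Y_len_pos (f j) y).le) 0) (Dd (f j) U ν ∘ₗ (𝔬12 (f j)).G0 U ∘ₗ (𝔬12 (f j)).Tpi U) (fun a b => θD * ((geo9Y (f j)).M * α₀) * Real.exp (-(δK * (geo9Y (f j)).dist a b))) ∧
            HasMaj (bXH (f j) U) (cNormR 1 (H (f j)) (𝔬12 (f j)).blk (fun y => (geo9Y_len_pos (f j) y).le) 0) (Dd (f j) U ν ∘ₗ (𝔬12 (f j)).G0 U ∘ₗ ((𝔬12 (f j)).Tpi U + (𝔬12 (f j)).T2 U)) (fun a b => θD * ((geo9Y (f j)).M * α₀) * Real.exp (-(δK * (geo9Y (f j)).dist a b)))) ∧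
          (∀ β : ℝ, 0 ≤ β → β < 1 →
            HasMaj (bXH (f j) U) (cNormR 1 (H (f j)) (𝔭A (f j)).blkPX (fun y => (geo9Y_len_pos (f j) y).le) (β - 1)) (((𝔭A (f j)).ΦX U β ∘ₗ (𝔬12 (f j)).G0 U) ∘ₗ (𝔬12 (f j)).Tpi U) (fun a b => θH β * ((geo9Y (f j)).M * α₀) * Real.exp (-(δK * (geo9Y (f j)).dist a b))) ∧
            HasMaj (bXH (f j) U) (cNormR 1 (H (f j)) (𝔭A (f j)).blkPX (fun y => (geo9Y_len_pos (f j) y).le) (β - 1)) (((𝔭A (f j)).ΦX U β ∘ₗ (𝔬12 (f j)).G0 U) ∘ₗ ((𝔬12 (f j)).Tpi U + (𝔬12 (f j)).T2 U)) (fun a b => θH β * ((geo9Y (f j)).M * α₀) * Real.exp (-(δK * (geo9Y (f j)).dist a b)))) ∧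
          (∀ (ν : Fin (d + 1)) (β : ℝ), 0 ≤ β → β < 1 →
            HasMaj (bXH (f j) U) (cNormR 1 (H (f j)) (𝔭A (f j)).blkPX (fun y => (geo9Y_len_pos (f j) y).le) β) (((𝔭A (f j)).ΦX U β ∘ₗ Dd (f j) U ν ∘ₗ (𝔬12 (f j)).G0 U) ∘ₗ (𝔬12 (f j)).Tpi U) (fun a b => θH β * ((geo9Y (f j)).M * α₀) * Real.exp (-(δK * (geo9Y (f j)).dist a b))) ∧
            HasMaj (bXH (f j) U) (cNormR 1 (H (f j)) (𝔭A (f j)).blkPX (fun y => (geo9Y_len_pos (f j) y).le) β) (((𝔭A (f j)).ΦX U β ∘ₗ Dd (f j) U ν ∘ₗ (𝔬12 (f j)).G0 U) ∘ₗ ((𝔬12 (f j)).Tpi U + (𝔬12 (f j)).T2 U)) (fun a b => θH β * ((geo9Y (f j)).M * α₀) * Real.exp (-(δK * (geo9Y (f j)).dist a b)))) ∧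
          HasMaj (cNormR 1 (H (f j)) (𝔬12 (f j)).blkY (fun y => (geo9Y_len_pos (f j) y).le) 0) (bXH (f j) U) ((𝔬12 (f j)).G0 U ∘ₗ (𝔬12 (f j)).Dstar U) (fun a b => AD * Real.exp (-(δP * (geo9Y (f j)).dist a b))) ∧
          (∀ (μ : Fin (d + 1)) (ε : ℝ), 0 < ε → HasMaj (bHXA (f j) ε) (bXH (f j) U) ((𝔬12 (f j)).G0 U ∘ₗ Dsd (f j) U μ) (fun a b => AI ε * Real.exp (-(δP * (geo9Y (f j)).dist a b)))) ∧
          HasMaj (bXH (f j) U) (cNormR 1 (H (f j)) (𝔬12 (f j)).blk (fun y => (geo9Y_len_pos (f j) y).le) (-1)) LinearMap.id (fun a b => CR * Real.exp (-(δP * (geo9Y (f j)).dist a b))) ∧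
          (bXH (f j) U).κ ≤ (1 + CLip d ℓ) ∧
          (∃ Λ : ℝ, 0 ≤ Λ ∧ ∀ (y : (geo9Y (f j)).Site) (F : XBK (TrIdx N) (f j).toKIdx → ℝ), (bXH (f j) U).loc y F ≤ Λ * ∑ q : XBK (TrIdx N) (f j).toKIdx, |F q|)) ∧
        (StepS (𝔬12 (f j)) (weightNorm (bXH (f j) U) (rwt (geo9Y (f j)) (-1)) (rwt_nonneg (fun y => (geo9Y_len_pos (f j) y).le) (-1))) (θS * ((geo9Y (f j)).M * α₀)) δK U ∧
          HasMaj (weightNorm (bXH (f j) U) (rwt (geo9Y (f j)) (-1)) (rwt_nonneg (fun y => (geo9Y_len_pos (f j) y).le) (-1))) (cNorm 1 (H (f j)) (𝔬12 (f j)).blkY (fun y => (geo9Y_len_pos (f j) y).le) 1) ((𝔬12 (f j)).D U ∘ₗ (𝔬12 (f j)).G0 U ∘ₗ ((𝔬12 (f j)).Tpi U + (𝔬12 (f j)).T2 U)) (fun a b => θD * ((geo9Y (f j)).M * α₀) * Real.exp (-(δK * (geo9Y (f j)).dist a b))) ∧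
          (∀ ν : Fin (d + 1), HasMaj (weightNorm (bXH (f j) U) (rwt (geo9Y (f j)) (-1)) (rwt_nonneg (fun y => (geo9Y_len_pos (f j) y).le) (-1))) (cNorm 1 (H (f j)) (𝔬12 (f j)).blk (fun y => (geo9Y_len_pos (f j) y).le) 1) (Dd (f j) U ν ∘ₗ (𝔬12 (f j)).G0 U ∘ₗ ((𝔬12 (f j)).Tpi U + (𝔬12 (f j)).T2 U)) (fun a b => θD * ((geo9Y (f j)).M * α₀) * Real.exp (-(δK * (geo9Y (f j)).dist a b)))) ∧
          (∀ β : ℝ, 0 ≤ β → β < 1 → HasMaj (weightNorm (bXH (f j) U) (rwt (geo9Y (f j)) (-1)) (rwt_nonneg (fun y => (geo9Y_len_pos (f j) y).le) (-1))) (cNormR 1 (H (f j)) (𝔭A (f j)).blkPY (fun y => (geo9Y_len_pos (f j) y).le) (β - 1)) (((𝔭A (f j)).ΦY U β ∘ₗ (𝔬12 (f j)).D U ∘ₗ (𝔬12 (f j)).G0 U) ∘ₗ ((𝔬12 (f j)).Tpi U + (𝔬12 (f j)).T2 U)) (fun a b => θH β * ((geo9Y (f j)).M * α₀) * Real.exp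 (-(δK * (geo9Y (f j)).dist a b)))) ∧
          (∀ (ν : Fin (d + 1)) (β : ℝ), 0 ≤ β → β < 1 → HasMaj (weightNorm (bXH (f j) U) (rwt (geo9Y (f j)) (-1)) (rwt_nonneg (fun y => (geo9Y_len_pos (f j) y).le) (-1))) (cNormR 1 (H (f j)) (𝔭A (f j)).blkPX (fun y => (geo9Y_len_pos (f j) y).le) (β - 1)) (((𝔭A (f j)).ΦX U β ∘ₗ Dd (f j) U ν ∘ₗ (𝔬12 (f j)).G0 U) ∘ₗ ((𝔬12 (f j)).Tpi U + (𝔬12 (f j)).T2 U)) (fun a b => θH β * ((geo9Y (f j)).M * α₀) * Real.exp (-(δK * (geo9Y (f j)).dist a b)))) ∧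
          HasMaj (cNorm 1 (H (f j)) (𝔬12 (f j)).blk (fun y => (geo9Y_len_pos (f j) y).le) 0) (weightNorm (bXH (f j) U) (rwt (geo9Y (f j)) (-1)) (rwt_nonneg (fun y => (geo9Y_len_pos (f j) y).le) (-1))) ((𝔬12 (f j)).G0 U) (fun a b => A₀S * Real.exp (-(δP * (geo9Y (f j)).dist a b))) ∧
          HasMaj (cNorm 1 (H (f j)) (𝔬12 (f j)).blkW (fun y => (geo9Y_len_pos (f j) y).le) 1) (weightNorm (bXH (f j) U) (rwt (geo9Y (f j)) (-1)) (rwt_nonneg (fun y => (geo9Y_len_pos (f j) y).le) (-1))) ((𝔬12 (f j)).G0 U ∘ₗ (𝔬12 (f j)).Dv U) (fun a b => AW * Real.exp (-(δP * (geo9Y (f j)).dist a b))) ∧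
          HasMaj (weightNorm (BlockNorm.ofBlocks (toB6 (geo9Y (f j)) 1 (H (f j))) (𝔬12 (f j)).blkZ) (fun y => ((((ℓ + 1 : ℕ) : ℝ) ^ (d + 1)) ^ lvl (f j).hN (f j).D (f j).hk y)⁻¹) (fun y => (plateau_pos (f j).toKIdx y).le)) (weightNorm (bXH (f j) U) (rwt (geo9Y (f j)) (-1)) (rwt_nonneg (fun y => (geo9Y_len_pos (f j) y).le) (-1))) ((𝔬12 (f j)).G0 U ∘ₗ (𝔬12 (f j)).Qstar U) (fun a b => AQ * Real.exp (-(δP * (geo9Y (f j)).dist a b))) ∧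
          HasMaj (weightNorm (bXH (f j) U) (rwt (geo9Y (f j)) (-1)) (rwt_nonneg (fun y => (geo9Y_len_pos (f j) y).le) (-1))) (cNormR 1 (H (f j)) (𝔬12 (f j)).blk (fun y => (geo9Y_len_pos (f j) y).le) (-2)) LinearMap.id (fun a b => CR * Real.exp (-(δP * (geo9Y (f j)).dist a b))) ∧
          (∃ Λ : ℝ, 0 ≤ Λ ∧ ∀ (y : (geo9Y (f j)).Site) (F : XBK (TrIdx N) (f j).toKIdx → ℝ), (weightNorm (bXH (f j) U) (rwt (geo9Y (f j)) (-1)) (rwt_nonneg (fun y => (geo9Y_len_pos (f j) y).le) (-1))).loc y F ≤ Λ * ∑ q : XBK (TrIdx N) (f j).toKIdx, |F q|)) ∧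
        (StepS (𝔬12 (f j)) (bXH (f j) U) (θS * ((geo9Y (f j)).M * α₀)) δK U ∧
          (∀ ν : Fin (d + 1), HasMaj (bXH (f j) U) (cNormR 1 (H (f j)) (𝔬12 (f j)).blk (fun y => (geo9Y_len_pos (f j) y).le) 0) (Dd (f j) U ν ∘ₗ (𝔬12 (f j)).G0 U ∘ₗ ((𝔬12 (f j)).Tpi U + (𝔬12 (f j)).T2 U)) (fun a b => θD * ((geo9Y (f j)).M * α₀) * Real.exp (-(δK * (geo9Y (f j)).dist a b)))) ∧
          (∀ β : ℝ, 0 ≤ β → β < 1 → HasMaj (bXH (f j) U) (cNormR 1 (H (f j)) (𝔭A (f j)).blkPX (fun y => (geo9Y_len_pos (f j) y).le) (β - 1)) (((𝔭A (f j)).ΦX U β ∘ₗ (𝔬12 (f j)).G0 U) ∘ₗ ((𝔬12 (f j)).Tpi U + (𝔬12 (f j)).T2 U)) (fun a b => θH β * ((geo9Y (f j)).M * α₀) * Real.exp (-(δK * (geo9Y (f j)).dist a b)))) ∧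
          (∀ (ν : Fin (d + 1)) (β : ℝ), 0 ≤ β → β < 1 → HasMaj (bXH (f j) U) (cNormR 1 (H (f j)) (𝔭A (f j)).blkPX (fun y => (geo9Y_len_pos (f j) y).le) β) (((𝔭A (f j)).ΦX U β ∘ₗ Dd (f j) U ν ∘ₗ (𝔬12 (f j)).G0 U) ∘ₗ ((𝔬12 (f j)).Tpi U + (𝔬12 (f j)).T2 U)) (fun a b => θH β * ((geo9Y (f j)).M * α₀) * Real.exp (-(δK * (geo9Y (f j)).dist a b)))) ∧
          HasMaj (cNormR 1 (H (f j)) (𝔬12 (f j)).blkY (fun y => (geo9Y_len_pos (f j) y).le) 0) (bXH (f j) U) ((𝔬12 (f j)).G0 U ∘ₗ (𝔬12 (f j)).Dstar U) (fun a b => AD * Real.exp (-(δP * (geo9Y (f j)).dist a b))) ∧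
          (∀ (μ : Fin (d + 1)) (ε : ℝ), 0 < ε → HasMaj (bHXA (f j) ε) (bXH (f j) U) ((𝔬12 (f j)).G0 U ∘ₗ Dsd (f j) U μ) (fun a b => AI ε * Real.exp (-(δP * (geo9Y (f j)).dist a b)))) ∧
          (∀ ε : ℝ, 0 < ε → HasMaj (bW (f j) U ε) (bXH (f j) U) ((𝔬12 (f j)).G0 U ∘ₗ (𝔬12 (f j)).Dv U) (fun a b => AV ε * Real.exp (-(δP * (geo9Y (f j)).dist a b)))) ∧
          HasMaj (weightNorm (BlockNorm.ofBlocks (toB6 (geo9Y (f j)) 1 (H (f j))) (𝔬12 (f j)).blkZ) (fun y => (geo9Y (f j)).len y * ((((ℓ + 1 : ℕ) : ℝ) ^ (d + 1)) ^ lvl (f j).hN (f j).D (f j).hk y)⁻¹) (fun y => (mul_pos (geo9Y_len_pos (f j) y) (plateau_pos (f j).toKIdx y)).le)) (bXH (f j) U) ((𝔬12 (f j)).G0 U ∘ₗ (𝔬12 (f j)).Qstar U) (fun a b => AQ1 * Real.exp (-(δP * (geo9Y (f j)).dist a b))) ∧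
          HasMaj (bXH (f j) U) (cNormR 1 (H (f j)) (𝔬12 (f j)).blk (fun y => (geo9Y_len_pos (f j) y).le) (-1)) LinearMap.id (fun a b => CR * Real.exp (-(δP * (geo9Y (f j)).dist a b))) ∧
          (∃ Λ : ℝ, 0 ≤ Λ ∧ ∀ (y : (geo9Y (f j)).Site) (F : XBK (TrIdx N) (f j).toKIdx → ℝ), (bXH (f j) U).loc y F ≤ Λ * ∑ q : XBK (TrIdx N) (f j).toKIdx, |F q|)) := by
  have hG : ∀ x : MemberY d ℓ hd hL b₀ b₁ Mstar, GeoOK (geo9Y x) := fun x => ⟨geo9Y_dist_triangle x, geo9Y_dist_comm x, geo9K_dist_nonneg x.toKIdx, geo9Y_len_pos x⟩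
  have hcb : 0 ≤ coordBound39 (trBasis N) := norm_nonneg _
  have hbb : 0 ≤ basisBound39 (trBasis N) := Finset.sum_nonneg fun _ _ => norm_nonneg _
  have hL1 : (0 : ℝ) ≤ (((ℓ + 1 : ℕ) : ℝ)) := Nat.cast_nonneg _
  have hCL : 0 ≤ CLip d ℓ := CLip_nonneg d ℓ
  have hc261 : 0 ≤ rowConst261 (@geo9Y d ℓ hd hL b₀ b₁ Mstar) σ := rowConst261_nonneg _ _
  have hδ12₀ : 0 ≤ δ12₀ := by linarith
  have hδP0 : 0 ≤ δP := by linarith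
  -- STEP 0: T_b into the Hölder class (rate ρ_T = δK + τ + σ, common budget r = δK + 3σ + 4τ)
  set T₂ : ℝ := ((CTel d ℓ (trBasis N) (δK + τ + σ) (B₀ * (((ℓ + 1 : ℕ) : ℝ)) * ((cR39 (trBasis N))⁻¹ * (tJ * (((ℓ + 1 : ℕ) : ℝ)) ^ 2)) * rowConst261 (@geo9Y d ℓ hd hL b₀ b₁ Mstar) σ) (B₀ * (((ℓ + 1 : ℕ) : ℝ)) * ((cR39 (trBasis N))⁻¹ * (tJ * (((ℓ + 1 : ℕ) : ℝ)) ^ 2)) * rowConst261 (@geo9Y d ℓ hd hL b₀ b₁ Mstar) σ) + CTel d ℓ (trBasis N) (δK + τ + σ) (CP * (((ℓ + 1 : ℕ) : ℝ)) * (B₀ * (((ℓ + 1 : ℕ) : ℝ)) * ((cR39 (trBasis N))⁻¹ * (tJ * (((ℓ + 1 : ℕ) : ℝ)) ^ 2)) * rowConst261 (@geo9Y d ℓ hd hL b₀ b₁ Mstar) σ) * rowConst261 (@geo9Y d ℓ hd hL b₀ b₁ Mstar) σ) (CP * (((ℓ + 1 : ℕ) : ℝ)) * (B₀ * (((ℓ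 + 1 : ℕ) : ℝ)) * ((cR39 (trBasis N))⁻¹ * (tJ * (((ℓ + 1 : ℕ) : ℝ)) ^ 2)) * rowConst261 (@geo9Y d ℓ hd hL b₀ b₁ Mstar) σ) * rowConst261 (@geo9Y d ℓ hd hL b₀ b₁ Mstar) σ)) + (B43 * ((cR39 (trBasis N))⁻¹ * tA) * rowConst261 (@geo9Y d ℓ hd hL b₀ b₁ Mstar) σ + CTel d ℓ (trBasis N) (δK + τ + σ) (CP * (((ℓ + 1 : ℕ) : ℝ)) * (B₀ * ((cR39 (trBasis N))⁻¹ * tA) * rowConst261 (@geo9Y d ℓ hd hL b₀ b₁ Mstar) σ) * rowConst261 (@geo9Y d ℓ hd hL b₀ b₁ Mstar) σ) (CP * (((ℓ + 1 : ℕ) : ℝ)) * (B₀ * ((cR39 (trBasis N))⁻¹ * tA) * rowConst261 (@geo9Y d ℓ hd hL b₀ b₁ Mstar) σ) * rowConst261 (@geo9Y d ℓ hd hL b₀ b₁ Mstar) σ)) + (B43 * ((cR39 (trBasis N))⁻¹ * tA) * rowConst261 (@geo9Y d ℓ hd hL b₀ b₁ Mstar) σ + CTel d ℓ (trBasis N)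 (δK + τ + σ) (CP * (((ℓ + 1 : ℕ) : ℝ)) * (B₀ * ((cR39 (trBasis N))⁻¹ * tA) * rowConst261 (@geo9Y d ℓ hd hL b₀ b₁ Mstar) σ) * rowConst261 (@geo9Y d ℓ hd hL b₀ b₁ Mstar) σ) (CP * (((ℓ + 1 : ℕ) : ℝ)) * (B₀ * ((cR39 (trBasis N))⁻¹ * tA) * rowConst261 (@geo9Y d ℓ hd hL b₀ b₁ Mstar) σ) * rowConst261 (@geo9Y d ℓ hd hL b₀ b₁ Mstar) σ))) with hT₂
  obtain ⟨MT1, hTb⟩ := N06TbHLegAtPinsPhysPUParJ.htbH_of_pinsP43_geo9Y_par_J (parT := parT) (N := N) (H := H) (f := f) (bI := bI) (hlev := hlev) (hβ1 := hβ1) (hGR := hGR) (c := c) (M₀ := M₀) (a₀ := a₀) (hM₀ := hM₀) (hσ := hσ) (hτ := hτ)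
    (w13 := w13) (hw13₀ := hw13₀) (hw13₁ := hw13₁) (bH13 := bH13) (hbH13 := hbH13) (𝔬12 := 𝔬12) (hblk12 := hblk12) (hblkW12 := hblkW12)
    (hB₀ := hB₀) (hCP := hCP) (htJ := htJ) (hB43 := hB43) (htA := htA) (hr₀ := (by linarith : (δK + 3 * σ + 4 * τ) ≤ δ₀)) (hrP := (by linarith : (δK + 3 * σ + 4 * τ) ≤ δ49)) (hrB := (by linarith : (δK + 3 * σ + 4 * τ) ≤ δB))
    (hρ := (by linarith : 0 ≤ (δK + τ + σ))) (hρT := (hrT : (δK + τ + σ) ≤ δT)) (hbud := (by linarith : (δK + τ + σ) + σ + τ ≤ (δK + 3 * σ + 4 * τ))) (hbud43 := (by linarith : (δK + τ + σ) + σ ≤ δ43))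
    (t₂ := T₂) (ht₂ := le_of_eq hT₂.symm) (hGp := hGp) (hparS := hparS) (h31 := h31) (h49 := h49) (h43 := h43)
  have hta' : ∀ j : J, max M₀ MT1 ≤ (geo9Y (f j)).M → ∀ α₀ : ℝ, 0 < α₀ → (geo9Y (f j)).M * α₀ ≤ a₀ → ∀ U : (bg9YR (Matrix (Fin N) (Fin N) ℂ) (specialUnitaryUnits (Fin N)) R₁ R₂ (f j)).Cfg, (bg9YR (Matrix (Fin N) (Fin N) ℂ) (specialUnitaryUnits (Fin N)) R₁ R₂ (f j)).Reg335 c α₀ U → (bg9YR (Matrix (Fin N) (Fin N) ℂ) (specialUnitaryUnits (Fin N)) R₁ R₂ (f j)).Reg336 c α₀ U →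
      HasMaj (cNorm 1 (H (f j)) (𝔬12 (f j)).blk (fun y => (geo9Y_len_pos (f j) y).le) 2) (cNorm 1 (H (f j)) (𝔬12 (f j)).blk (fun y => (geo9Y_len_pos (f j) y).le) 0) (TaLcoK (f j).toKIdx (trBasis N) (bg9YR (Matrix (Fin N) (Fin N) ℂ) (specialUnitaryUnits (Fin N)) R₁ R₂ (f j)) (fun U => U) (parT (f j).toKIdx) (GpPhysY (f j).toKIdx (parT (f j).toKIdx)) U)
        (fun a a' => max tA T₂ * ((geo9Y (f j)).M * α₀) * Real.exp (-((δK + τ + σ) * (geo9Y (f j)).dist a a'))) := fun j hM α₀ hα ha U hU hU' =>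
    hasMaj_weaken (hG (f j)) (mul_nonneg htA (mul_nonneg (hM₀.trans ((le_max_left _ _).trans hM)) hα.le)) (mul_le_mul_of_nonneg_right (le_max_left _ _) (mul_nonneg (hM₀.trans ((le_max_left _ _).trans hM)) hα.le)) hrT
      (hta j ((le_max_left _ _).trans hM) α₀ hα ha U hU hU')
  have htbH' : ∀ j : J, max M₀ MT1 ≤ (geo9Y (f j)).M → ∀ α₀ : ℝ, 0 < α₀ → (geo9Y (f j)).M * α₀ ≤ a₀ → ∀ U : (bg9YR (Matrix (Fin N) (Fin N) ℂ) (specialUnitaryUnits (Fin N)) R₁ R₂ (f j)).Cfg, (bg9YR (Matrix (Fin N) (Fin N) ℂ) (specialUnitaryUnits (Fin N)) R₁ R₂ (f j)).Reg335 c α₀ U → (bg9YR (Matrix (Fin N) (Fin N) ℂ) (specialUnitaryUnits (Fin N)) R₁ R₂ (f j)).Reg336 c α₀ U →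
      HasMaj (cNorm 1 (H (f j)) (𝔬12 (f j)).blk (fun y => (geo9Y_len_pos (f j) y).le) 2) (bH13 (f j) U) (TbLcoKH (f j).toKIdx (trBasis N) (bg9YR (Matrix (Fin N) (Fin N) ℂ) (specialUnitaryUnits (Fin N)) R₁ R₂ (f j)) (fun U => U) (parT (f j).toKIdx) (GpPhysY (f j).toKIdx (parT (f j).toKIdx)) U)
        (fun a a' => max tA T₂ * ((geo9Y (f j)).M * α₀) * Real.exp (-((δK + τ + σ) * (geo9Y (f j)).dist a a'))) := fun j hM α₀ hα ha U hU hU' =>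
    (hTb j ((le_max_right _ _).trans hM) α₀ hα ha U hU hU' (hBJ (f j) ((le_max_left _ _).trans hM) α₀ hα ha U hU hU') (hta j ((le_max_left _ _).trans hM) α₀ hα ha U hU hU')).mono
      fun a b => mul_le_mul_of_nonneg_right (mul_le_mul_of_nonneg_right (le_max_right _ _) (mul_nonneg (hM₀.trans ((le_max_left _ _).trans hM)) hα.le)) (Real.exp_nonneg _)
  -- STEP 1: the (3.131)∕(3.137) letters on 𝔖₂ (rate δ_S = δK + τ, constant TS)
  set TS : ℝ := max ((max tA T₂) * ((wX s44)⁻¹ * ((((ℓ + 1 : ℕ) : ℝ)) * Real.exp (((δK + τ) + τ) * (rNear d ℓ + 1))) * (((ℓ + 1 : ℕ) : ℝ))) * rowConst261 (@geo9Y d ℓ hd hL b₀ b₁ Mstar) σ) (max (θ₂ * ((((ℓ + 1 : ℕ) : ℝ)) ^ 2 * (((wX s44)⁻¹ * ((((ℓ + 1 : ℕ) : ℝ)) * Real.exp (((δK + 3 * σ + 4 * τ) + τ) * (rNear d ℓ + 1))) * (((ℓ + 1 : ℕ) : ℝ))) + (cR39 (trBasis N))⁻¹ * ((wX s44)⁻¹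 * B44 * (((ℓ + 1 : ℕ) : ℝ))) + (cR39 (trBasis N))⁻¹ * (B₀ * (((ℓ + 1 : ℕ) : ℝ)) * (CP * (((ℓ + 1 : ℕ) : ℝ)) ^ 2) * (rowConst261 (@geo9Y d ℓ hd hL b₀ b₁ Mstar) σ) * ((wX s44)⁻¹ * ((((ℓ + 1 : ℕ) : ℝ)) * Real.exp (((δK + 3 * σ + 4 * τ) + τ) * (rNear d ℓ + 1))) * (((ℓ + 1 : ℕ) : ℝ))) * (rowConst261 (@geo9Y d ℓ hd hL b₀ b₁ Mstar) σ))) * (rowConst261 (@geo9Y d ℓ hd hL b₀ b₁ Mstar) σ))) (B43 * ((cR39 (trBasis N))⁻¹ * (θ₂ * ((((ℓ + 1 : ℕ) : ℝ)) ^ 2 * (((wX s44)⁻¹ * ((((ℓ + 1 : ℕ) : ℝ)) * Real.exp (((δK + 3 * σ + 4 * τ) + τ) * (rNear d ℓ + 1))) * (((ℓ + 1 : ℕ) : ℝ))) + (cR39 (trBasis N))⁻¹ * ((wX s44)⁻¹ * B44 * (((ℓ + 1 : ℕ) : ℝ))) + (cR39 (trBasis N))⁻¹ * (B₀ * (((ℓ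 + 1 : ℕ) : ℝ)) * (CP * (((ℓ + 1 : ℕ) : ℝ)) ^ 2) * (rowConst261 (@geo9Y d ℓ hd hL b₀ b₁ Mstar) σ) * ((wX s44)⁻¹ * ((((ℓ + 1 : ℕ) : ℝ)) * Real.exp (((δK + 3 * σ + 4 * τ) + τ) * (rNear d ℓ + 1))) * (((ℓ + 1 : ℕ) : ℝ))) * (rowConst261 (@geo9Y d ℓ hd hL b₀ b₁ Mstar) σ))) * (rowConst261 (@geo9Y d ℓ hd hL b₀ b₁ Mstar) σ)))) * rowConst261 (@geo9Y d ℓ hd hL b₀ b₁ Mstar) σ +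
      CTel d ℓ (trBasis N) (δK + τ)
        (CP * (((ℓ + 1 : ℕ) : ℝ)) * (B₀ * ((cR39 (trBasis N))⁻¹ * (θ₂ * ((((ℓ + 1 : ℕ) : ℝ)) ^ 2 * (((wX s44)⁻¹ * ((((ℓ + 1 : ℕ) : ℝ)) * Real.exp (((δK + 3 * σ + 4 * τ) + τ) * (rNear d ℓ + 1))) * (((ℓ + 1 : ℕ) : ℝ))) + (cR39 (trBasis N))⁻¹ * ((wX s44)⁻¹ * B44 * (((ℓ + 1 : ℕ) : ℝ))) + (cR39 (trBasis N))⁻¹ * (B₀ * (((ℓ + 1 : ℕ) : ℝ)) * (CP * (((ℓ + 1 : ℕ) : ℝ)) ^ 2) * (rowConst261 (@geo9Y d ℓ hd hL b₀ b₁ Mstar) σ) * ((wX s44)⁻¹ * ((((ℓ + 1 : ℕ) : ℝ)) * Real.exp (((δK + 3 * σ + 4 * τ) + τ) * (rNear d ℓ + 1))) * (((ℓ + 1 : ℕ) : ℝ))) * (rowConst261 (@geo9Y d ℓ hd hL b₀ b₁ Mstar) σ))) * (rowConst261 (@geo9Y d ℓ hd hL b₀ b₁ Mstar) σ)))) * rowConst261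 (@geo9Y d ℓ hd hL b₀ b₁ Mstar) σ) * rowConst261 (@geo9Y d ℓ hd hL b₀ b₁ Mstar) σ)
        (CP * (((ℓ + 1 : ℕ) : ℝ)) * (B₀ * ((cR39 (trBasis N))⁻¹ * (θ₂ * ((((ℓ + 1 : ℕ) : ℝ)) ^ 2 * (((wX s44)⁻¹ * ((((ℓ + 1 : ℕ) : ℝ)) * Real.exp (((δK + 3 * σ + 4 * τ) + τ) * (rNear d ℓ + 1))) * (((ℓ + 1 : ℕ) : ℝ))) + (cR39 (trBasis N))⁻¹ * ((wX s44)⁻¹ * B44 * (((ℓ + 1 : ℕ) : ℝ))) + (cR39 (trBasis N))⁻¹ * (B₀ * (((ℓ + 1 : ℕ) : ℝ)) * (CP * (((ℓ + 1 : ℕ) : ℝ)) ^ 2) * (rowConst261 (@geo9Y d ℓ hd hL b₀ b₁ Mstar) σ) * ((wX s44)⁻¹ * ((((ℓ + 1 : ℕ) : ℝ)) * Real.exp (((δK + 3 * σ + 4 * τ) + τ) * (rNear d ℓ + 1))) * (((ℓ + 1 : ℕ) : ℝ))) * (rowConst261 (@geo9Y d ℓ hd hL b₀ b₁ Mstar)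 σ))) * (rowConst261 (@geo9Y d ℓ hd hL b₀ b₁ Mstar) σ)))) * rowConst261 (@geo9Y d ℓ hd hL b₀ b₁ Mstar) σ) * rowConst261 (@geo9Y d ℓ hd hL b₀ b₁ Mstar) σ))) with hTS
  have hTS0 : 0 ≤ TS := le_max_of_le_left (mul_nonneg (mul_nonneg (le_max_of_le_left htA) (by positivity)) hc261)
  obtain ⟨MT2, hLS⟩ := N06LettersSAtPinsPUParJ.hLettersS_of_pinsP44_geo9Y_par_J (parT := parT) (N := N) (H := H) (f := f) (bI := bI) (hlev := hlev) (hβ1 := hβ1) (hbI0 := hbI0) (hGR := hGR) (c := c) (M₀ := max M₀ MT1) (a₀ := a₀)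
    (hM₀ := le_max_of_le_left hM₀) (hσ := hσ) (hτ := hτ) (w13 := w13) (hw13₀ := hw13₀) (hw13₁ := hw13₁) (bH13 := bH13) (hbH13 := hbH13) (wX := wX) (hwX₀ := hwX₀) (hwX₁ := hwX₁) (bXH := bXH) (hbXH := hbXH)
    (hs440 := hs440) (hs441 := hs441) (hwX44 := hwX44) (𝔬12 := 𝔬12) (hblk12 := hblk12) (Δ2 := Δ2) (hTpico12 := hTpico12) (hT2co12 := hT2co12) (hDvco12 := hDvco12)
    (hB₀ := hB₀) (hCP := hCP) (hθ₂ := hθ₂) (hB44 := hB44) (hB43 := hB43) (htA := le_max_of_le_left htA) (hr := (by linarith : 0 ≤ (δK + 3 * σ + 4 * τ))) (hr₀ := hr0) (hrP := hr49) (hr₂ := hr2) (hr44 := (by linarith : (δK + 3 * σ + 4 * τ) + τ ≤ δ44))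
    (hδS := (by linarith : 0 ≤ (δK + τ))) (hbud := (by linarith : (δK + τ) + 3 * σ + 3 * τ ≤ (δK + 3 * σ + 4 * τ))) (hbud43 := (by linarith : (δK + τ) + σ ≤ δ43)) (hbudT := (by linarith : (δK + τ) + σ ≤ (δK + τ + σ)))
    (tS := TS) (htS₁ := le_max_left _ _) (htS₂ := (le_max_left _ _).trans (le_max_right _ _)) (htS₃ := (le_max_right _ _).trans (le_max_right _ _)) (hGp := hGp) (hparS := hparS)
    (h31 := (fun x hM => h31 x ((le_max_left _ _).trans hM))) (h49 := (fun j hM => h49 j ((le_max_left _ _).trans hM))) (h43 := (fun x hM => h43 x ((le_max_left _ _).trans hM))) (h44G := (fun x hM => h44G x ((le_max_left _ _).trans hM))) (hDvsco12 := hDvsco12)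
    (hD2 := (fun j hM => hD2 j ((le_max_left _ _).trans hM))) (hta := hta') (htbH := htbH')
  -- STEP 2a: G₀∇_U : 𝔠_W⁽¹⁾ → 𝔖₂, the two readings, κ, ℓ¹ (rate δP + σ)
  set ADF : ℝ := (((ℓ + 1 : ℕ) : ℝ)) * (B12₃ * (((ℓ + 1 : ℕ) : ℝ)) + Bx13₀) * Real.exp (((δP + σ) + τ) * (rNear d ℓ + 1)) * (((ℓ + 1 : ℕ) : ℝ)) with hADF
  set CRF : ℝ := (wX s44)⁻¹ * ((((ℓ + 1 : ℕ) : ℝ)) * Real.exp (((δP + σ) + 2 * τ) * (rNear d ℓ + 1))) * (((ℓ + 1 : ℕ) : ℝ)) * (((ℓ + 1 : ℕ) : ℝ)) with hCRF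
  have hADF0 : 0 ≤ ADF := mul_nonneg (mul_nonneg (mul_nonneg hL1 (add_nonneg (mul_nonneg hB12₃ hL1) hBx13₀)) (Real.exp_nonneg _)) hL1
  have hCRF0 : 0 ≤ CRF := by positivity
  obtain ⟨MT3, hSF⟩ := hStateFacts_of_pinsP_geo9Y (N := N) (H := H) (bI := bI) (hlev := hlev) (hβ1 := hβ1) (hbI0 := hbI0) (c := c) (M₀ := M₀) (a₀ := a₀) (hτ := hτ) (wX := wX) (hwX₀ := hwX₀) (hwX₁ := hwX₁)
    (bXH := bXH) (hbXH := hbXH) (hs440 := hs440) (hs441 := hs441) (hwX44 := hwX44) (𝔬12 := 𝔬12) (hblk12 := hblk12) (hblkW12 := hblkW12) (𝔭A := 𝔭A) (hparB := hparB) (h𝔭A := h𝔭A)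
    (hB12₃ := hB12₃) (hBx13 := hBx13) (hBx13₀ := hBx13₀) (hwBx13 := hwBx13) (hδS := (by linarith : 0 ≤ δP + σ)) (hδS₃ := (by linarith : δP + σ + 2 * τ ≤ δ12₃))
    (AD := ADF) (CR := CRF) (hAD := le_of_eq hADF.symm) (hCR := le_of_eq hCRF.symm) (hZ81 := hZ81) (hpXDv := hpXDv)
  -- STEP 2b-A₀: G₀ : 𝔠⁽⁰⁾ → 𝔖₂ (rate δP)
  set A0c : ℝ := (((ℓ + 1 : ℕ) : ℝ)) * (B12₀ * (((ℓ + 1 : ℕ) : ℝ)) + (coordBound39 (trBasis N) * ((d : ℝ) + 1) * basisBound39 (trBasis N) * B12₀ * ((ℓ : ℝ) + 1) * Real.exp (δ12₀ * (((d : ℝ) + 1) * (((ℓ : ℝ) + 1) + 1) + 2)) + B12₀ + coordBound39 (trBasis N) * basisBound39 (trBasis N) * B12₀) * (((ℓ + 1 : ℕ) : ℝ))) * Real.exp ((δP + τ) * (rNear d ℓ + 1)) * (((ℓ + 1 : ℕ) : ℝ)) with hA0c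
  have hA0c0 : 0 ≤ A0c := by positivity
  obtain ⟨MT4, hPG0⟩ := hG0S2_of_pinsP_geo9Y (N := N) (H := H) (bI := bI) (hlev := hlev) (hβ1 := hβ1) (hbI0 := hbI0) (hGR := hGR) (c := c) (M₀ := M₀) (a₀ := a₀) (hτ := hτ) (wX := wX) (hwX₀ := hwX₀) (hwX₁ := hwX₁)
    (bXH := bXH) (hbXH := hbXH) (𝔬12 := 𝔬12) (hblk12 := hblk12) (𝔭A := 𝔭A) (hparB := hparB) (h𝔭A := h𝔭A) (Dd := Dd) (hDd := hDd)
    (hB₀ := hB12₀) (hδS := hδP0) (hδS₀ := hP0) (A₀ := A0c) (hA₀ := le_of_eq hA0c.symm) (he0 := he0) (he1d := he1d)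
  -- STEP 2b-A: G₀∇*_U, G₀Q* (both classes), G₀∇_U out of the Hölder class (rate δP)
  set ADA : ℝ := (((ℓ + 1 : ℕ) : ℝ)) * (B₀G + BHG) * Real.exp (δ₀G * (rNear d ℓ + 1)) with hADA
  set AQ1A : ℝ := (((ℓ + 1 : ℕ) : ℝ)) * (B12₃ + Bx13₀) * Real.exp (δ12₃ * (rNear d ℓ + 1)) with hAQ1A
  set AQA : ℝ := (((ℓ + 1 : ℕ) : ℝ)) * (B12₃ + Bx13₀) * Real.exp (δ12₃ * (rNear d ℓ + 1)) * (((ℓ + 1 : ℕ) : ℝ)) with hAQA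
  set AWA : ℝ := ADF * ((w13 s44)⁻¹ * ((((ℓ + 1 : ℕ) : ℝ)) * Real.exp ((δP + σ) * (rNear d ℓ + 1)))) * rowConst261 (@geo9Y d ℓ hd hL b₀ b₁ Mstar) σ with hAWA
  have hADA0 : 0 ≤ ADA := by positivity
  have hAQ1A0 : 0 ≤ AQ1A := by positivity
  have hAQA0 : 0 ≤ AQA := by positivity
  have hAWA0 : 0 ≤ AWA := mul_nonneg (mul_nonneg hADF0 (by positivity)) hc261
  obtain ⟨MT5, hPA⟩ := hProducersA_of_pinsP_geo9Y (N := N) (H := H) (bI := bI) (hlev := hlev) (hβ1 := hβ1) (hbI0 := hbI0) (c := c) (M₀ := max M₀ MT3) (a₀ := a₀) (hσ := hσ) (hτ := hτ)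
    (w13 := w13) (hw13₀ := hw13₀) (hw13₁ := hw13₁) (bH13 := bH13) (hbH13 := hbH13) (wX := wX) (hwX₀ := hwX₀) (hwX₁ := hwX₁) (bXH := bXH) (hbXH := hbXH) (hs440 := hs440) (hs441 := hs441) (hw1344 := hw1344)
    (𝔬12 := 𝔬12) (hblk12 := hblk12) (hblkW12 := hblkW12) (𝔭A := 𝔭A) (hparB := hparB) (h𝔭A := h𝔭A)
    (hB₀G := hB₀G) (hBhG := hBhG) (hBHG := hBHG) (hwBhG := hwBhG) (hB12₃ := hB12₃) (hBx13 := hBx13) (hBx13₀ := hBx13₀) (hwBx13 := hwBx13) (hAW0 := hADF0) (hδP := hδP0)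
    (hδP₀ := hPG) (hδP₃ := (by linarith : δP + τ ≤ δ12₃)) (hδPW := (le_rfl : δP + σ ≤ δP + σ))
    (AD := ADA) (AQ1 := AQ1A) (AQ := AQA) (AW' := AWA) (hAD := le_of_eq hADA.symm) (hAQ1 := le_of_eq hAQ1A.symm) (hAQ := le_of_eq hAQA.symm) (hAW := le_of_eq hAWA.symm)
    (he2 := (fun x hM => he2 x ((le_max_left _ _).trans hM))) (h43RG := (fun x hM => h43RG x ((le_max_left _ _).trans hM))) (hgQs1 := (fun x hM => hgQs1 x ((le_max_left _ _).trans hM))) (hpXQs := (fun x hM => hpXQs x ((le_max_left _ _).trans hM)))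
    (hGDW := fun x hM α₀ hα ha U hU hU' => (hSF x ((le_max_right _ _).trans hM) α₀ hα ha U hU hU').1)
  -- STEP 2b-B: G₀∇*_{U,μ} out of `bHXA ε`, G₀∇_U out of the site class `bW U ε` (rate δP; variant `W`)
  obtain ⟨MT6, hPB⟩ := hProducersBW_of_pinsP_geo9Y (N := N) (H := H) (bI := bI) (hlev := hlev) (hβ1 := hβ1) (hbI0 := hbI0) (hGR := hGR) (c := c) (M₀ := M₀) (a₀ := a₀) (hτ := hτ) (wX := wX) (hwX₀ := hwX₀) (hwX₁ := hwX₁)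
    (bXH := bXH) (hbXH := hbXH) (bHXA := bHXA) (hbHXA := hbHXA) (bW := bW) (𝔬12 := 𝔬12) (hblk12 := hblk12) (hblkW12 := hblkW12) (Dd := Dd) (Dsd := Dsd) (hDd := hDd)
    (hB₀ := hB12₀) (hBi := hBi) (hB12₃ := hB12₃) (hBd := hBd) (hCW := hCW) (hδP := hδP0) (hδP₀ := (by linarith : δP ≤ δ12₀)) (hδP₃ := (by linarith : δP + τ ≤ δ12₃))
    (hDirR := hDirR) (hDir := hDir) (hZ81 := hZ81) (hdgDvd := hdgDvd) (htransW := htransW)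
  -- STEP 2c: StepS + the one-step pairs (rate ρ = δK + τ on 𝔖₂, ρ − τ on 𝔖₁)
  set CX0 : ℝ := (coordBound39 (trBasis N) * ((d : ℝ) + 1) * basisBound39 (trBasis N) * B12₀ * ((ℓ : ℝ) + 1) * Real.exp (δ12₀ * (((d : ℝ) + 1) * (((ℓ : ℝ) + 1) + 1) + 2)) + B12₀ + coordBound39 (trBasis N) * basisBound39 (trBasis N) * B12₀) with hCX0
  have hCX00 : 0 ≤ CX0 := by positivity
  set MP : ℝ := max (max (max M₀ MT2) MT4) MT5 with hMP
  have hMP0 : M₀ ≤ MP := ((le_max_left _ _).trans (le_max_left _ _)).trans (le_max_left _ _)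
  have hMP2 : MT2 ≤ MP := (le_max_right _ _).trans ((le_max_left _ _).trans (le_max_left _ _))
  obtain ⟨MT7, hPR⟩ := N06StatePairsAtPinsPUJ.hStatePairs_of_pinsP_geo9Y_J (N := N) (H := H) (f := f) (bI := bI) (hlev := hlev) (hβ1 := hβ1) (c := c) (M₀ := MP) (a₀ := a₀) (hM₀ := hM₀.trans hMP0) (hσ := hσ) (hτ := hτ)
    (w13 := w13) (hw13₀ := hw13₀) (hw13₁ := hw13₁) (bH13 := bH13) (hbH13 := hbH13) (hκ13 := hκ13) (bXH := bXH) (hs440 := hs440) (hs441 := hs441) (hw1344 := hw1344) (𝔬12 := 𝔬12) (hblkW12 := hblkW12) (𝔭A := 𝔭A) (Dd := Dd)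
    (Ta := fun x => TaLcoK x.toKIdx (trBasis N) (bg9YR (Matrix (Fin N) (Fin N) ℂ) (specialUnitaryUnits (Fin N)) R₁ R₂ x) (fun U => U) (parT x.toKIdx) (GpPhysY x.toKIdx (parT x.toKIdx)))
    (Ta₂ := fun x => Ta2LcoK x.toKIdx (trBasis N) (bg9YR (Matrix (Fin N) (Fin N) ℂ) (specialUnitaryUnits (Fin N)) R₁ R₂ x) (fun U => U) (parT x.toKIdx) (GpPhysY x.toKIdx (parT x.toKIdx)) (Δ2 x))
    (Tb := fun x => TbLcoKH x.toKIdx (trBasis N) (bg9YR (Matrix (Fin N) (Fin N) ℂ) (specialUnitaryUnits (Fin N)) R₁ R₂ x) (fun U => U) (parT x.toKIdx) (GpPhysY x.toKIdx (parT x.toKIdx)))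
    (Tb₂ := fun x => Tb2LcoKH x.toKIdx (trBasis N) (bg9YR (Matrix (Fin N) (Fin N) ℂ) (specialUnitaryUnits (Fin N)) R₁ R₂ x) (fun U => U) (parT x.toKIdx) (GpPhysY x.toKIdx (parT x.toKIdx)) (Δ2 x))
    (tS := TS) (htS := hTS0) (hA₀ := hA0c0) (hAW := hAWA0) (hB12₀ := hB12₀) (hB₃ := hB₃) (cX0 := CX0) (hcX0 := hCX00) (hBh12 := hBh12) (hBhD := hBhD) (hBdX := hBdX) (hBx13 := hBx13)
    (hρ := (by linarith : 0 ≤ (δK + τ))) (hρT := (le_rfl : (δK + τ) ≤ (δK + τ))) (hρ0 := (by linarith : (δK + τ) + σ ≤ δ12₀)) (hρ3 := (by linarith : (δK + τ) + σ ≤ δ₃)) (hρP := (by linarith : (δK + τ) + σ ≤ δP))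
    (hρX := (by linarith : (δK + τ) + 2 * σ + τ ≤ δ12₃))
    (hLS := fun j hM => hLS j (hMP2.trans hM))
    (hPG0 := fun x hM => hPG0 x (((le_max_right _ _).trans (le_max_left _ _)).trans hM)) (hPGD := fun x hM α₀ hα ha U hU hU' => (hPA x ((le_max_right _ _).trans hM) α₀ hα ha U hU hU').2.2.2)
    (he1 := fun x hM => he1 x (hMP0.trans hM)) (he1d := fun x hM => he1d x (hMP0.trans hM)) (h43L := fun x hM => h43L x (hMP0.trans hM)) (h43d := fun x hM => h43d x (hMP0.trans hM))
    (hpX0 := fun x hM α₀ hα ha U hU hU' β hβ hβ' => by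
      letI : Fintype (geo9K x.toKIdx).Site := (inferInstance : Fintype (geo9Y x).Site)
      exact pX0_of_pins x.toKIdx (trBasis N) (hG x) (fun U : (bg9YR (Matrix (Fin N) (Fin N) ℂ) (specialUnitaryUnits (Fin N)) R₁ R₂ x).Cfg => U) (hparB x) U (links_le_one hGR x hU) (hlev x) (hβ1 x) (h𝔭A x) (hblk12 x) (hDd x U)
        (fun y => (geo9Y_len_pos x y).le) ((𝔬12 x).G0 U) hB12₀ hδ12₀ (he0 x (hMP0.trans hM) α₀ hα ha U hU hU') (he1d x (hMP0.trans hM) α₀ hα ha U hU hU') hβ'.le)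
    (hdgDH := fun x hM => hdgDH x (hMP0.trans hM)) (hdgDHd := fun x hM => hdgDHd x (hMP0.trans hM)) (hYd := fun x hM => hYd x (hMP0.trans hM)) (hXd := fun x hM => hXd x (hMP0.trans hM))
    (hpXDv := fun x hM => hpXDv x (hMP0.trans hM))
  -- STEP 3: the assembly into the leaves' four state tuples
  set MS : ℝ := max (max (max (max (max M₀ MT7) MT4) MT3) MT5) MT6 with hMS
  have hFS := N06StateAssemblyAtPinsPUWJ.hStateAssemblyW_of_faces_J (N := N) (H := H) (f := f) (c := c) (bXH := bXH) (bH13 := bH13) (bHXA := bHXA) (bW := bW) (𝔬12 := 𝔬12) (𝔭A := 𝔭A) (Dd := Dd) (Dsd := Dsd)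
    (wZ := fun x y => ((((ℓ + 1 : ℕ) : ℝ) ^ (d + 1)) ^ lvl x.hN x.D x.hk y)⁻¹) (hwZ := fun x y => plateau_pos x.toKIdx y)
    (MTP := MT7) (aP := a₀) (MTG := MT4) (aG := a₀) (MTF := MT3) (aF := a₀) (MTA := MT5) (aA := a₀) (MTB := MT6) (aB := a₀) (M₁ := MS) (a₁ := a₀)
    (CS₂ := (2 * ((A0c + (1 + CLip d ℓ) * AWA) * TS * rowConst261 (@geo9Y d ℓ hd hL b₀ b₁ Mstar) σ))) (CS₁ := (2 * ((A0c + (1 + CLip d ℓ) * AWA) * TS * rowConst261 (@geo9Y d ℓ hd hL b₀ b₁ Mstar) σ) * (((ℓ + 1 : ℕ) : ℝ)))) (CD := (2 * ((B12₀ + (1 + CLip d ℓ) * B₃) * TS * rowConst261 (@geo9Y d ℓ hd hL b₀ b₁ Mstar) σ))) (ρ₂ := (δK + τ)) (ρ₁ := (δK + τ) - τ) (A₀ := A0c) (rG := δP) (AW := ADF) (CR := CRF) (κB := 1 + CLip d ℓ) (rF := δP + σ)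
    (AD := ADA) (AQ1 := AQ1A) (AQ := AQA) (AWH := AWA) (rA := δP) (rB := δP) (CY := fun β : ℝ => (2 * ((Bh12 β + (1 + CLip d ℓ) * BhD β) * TS * rowConst261 (@geo9Y d ℓ hd hL b₀ b₁ Mstar) σ))) (CXd := fun β : ℝ => (2 * ((Bh12 β + (1 + CLip d ℓ) * BdX β) * TS * rowConst261 (@geo9Y d ℓ hd hL b₀ b₁ Mstar) σ))) (CX := fun β : ℝ => (2 * ((CX0 + (1 + CLip d ℓ) * (1 * (Bx13 β * (((ℓ + 1 : ℕ) : ℝ))) * ((w13 s44)⁻¹ * ((((ℓ + 1 : ℕ) : ℝ)) * Real.exp ((δ12₃ - τ) * (rNear d ℓ + 1)))) * rowConst261 (@geo9Y d ℓ hd hL b₀ b₁ Mstar) σ)) * TS * rowConst261 (@geo9Y d ℓ hd hL b₀ b₁ Mstar) σ)))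
    (AI := fun ε : ℝ => ((ℓ + 1 : ℕ) : ℝ) * (((2 * (d + 1) : ℕ) : ℝ) * B12₀ + (coordBound39 (trBasis N) * ((d : ℝ) + 1) * basisBound39 (trBasis N) * Bi (min ε 1) * Real.exp (δ12₀ * (((d : ℝ) + 1) * (((ℓ : ℝ) + 1) + 1) + 2)) + ((2 * (d + 1) : ℕ) : ℝ) * B12₀ + coordBound39 (trBasis N) * basisBound39 (trBasis N) * (((2 * (d + 1) : ℕ) : ℝ) * B12₀))) * Real.exp (δ12₀ * (rNear d ℓ + 1)))
    (AV := fun ε : ℝ => ((ℓ + 1 : ℕ) : ℝ) * (CW * (B12₃ * (((ℓ + 1 : ℕ) : ℝ))) + (coordBound39 (trBasis N) * ((d : ℝ) + 1) * basisBound39 (trBasis N) * Bd ε * Real.exp ((δ12₃ - τ) * (((d : ℝ) + 1) * (((ℓ : ℝ) + 1) + 1) + 2)) + CW * (B12₃ * (((ℓ + 1 : ℕ) : ℝ))) + coordBound39 (trBasis N) * basisBound39 (trBasis N) * (CW * (B12₃ * (((ℓ + 1 : ℕ) : ℝ)))))) * Real.exp ((δ12₃ - τ) * (rNear d ℓ +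 1)))
    (θS := (max (2 * ((A0c + (1 + CLip d ℓ) * AWA) * TS * rowConst261 (@geo9Y d ℓ hd hL b₀ b₁ Mstar) σ)) (2 * ((A0c + (1 + CLip d ℓ) * AWA) * TS * rowConst261 (@geo9Y d ℓ hd hL b₀ b₁ Mstar) σ) * (((ℓ + 1 : ℕ) : ℝ))))) (θD := (max (2 * ((B12₀ + (1 + CLip d ℓ) * B₃) * TS * rowConst261 (@geo9Y d ℓ hd hL b₀ b₁ Mstar) σ)) ((2 * ((B12₀ + (1 + CLip d ℓ) * B₃) * TS * rowConst261 (@geo9Y d ℓ hd hL b₀ b₁ Mstar) σ)) * (((ℓ + 1 : ℕ) : ℝ))))) (δK := δK) (δP := δP) (κS := 1 + CLip d ℓ)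
    (θH := (fun β : ℝ => max (2 * ((Bh12 β + (1 + CLip d ℓ) * BhD β) * TS * rowConst261 (@geo9Y d ℓ hd hL b₀ b₁ Mstar) σ)) (max (2 * ((Bh12 β + (1 + CLip d ℓ) * BdX β) * TS * rowConst261 (@geo9Y d ℓ hd hL b₀ b₁ Mstar) σ)) (max ((2 * ((Bh12 β + (1 + CLip d ℓ) * BdX β) * TS * rowConst261 (@geo9Y d ℓ hd hL b₀ b₁ Mstar) σ)) * (((ℓ + 1 : ℕ) : ℝ))) ((2 * ((CX0 + (1 + CLip d ℓ) * (1 * (Bx13 β * (((ℓ + 1 : ℕ) : ℝ))) * ((w13 s44)⁻¹ * ((((ℓ + 1 : ℕ) : ℝ)) * Real.exp ((δ12₃ - τ) * (rNear d ℓ + 1)))) * rowConst261 (@geo9Y d ℓ hd hL b₀ b₁ Mstar) σ)) * TS * rowConst261 (@geo9Y d ℓ hd hL b₀ b₁ Mstar) σ)) * (((ℓ + 1 : ℕ) : ℝ)))))))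
    (hM₁ := hM₀.trans (((((le_max_left _ _).trans (le_max_left _ _)).trans (le_max_left _ _)).trans (le_max_left _ _)).trans (le_max_left _ _)))
    (hMP := ((((le_max_right _ _).trans (le_max_left _ _)).trans (le_max_left _ _)).trans (le_max_left _ _)).trans (le_max_left _ _))
    (hMG := (((le_max_right _ _).trans (le_max_left _ _)).trans (le_max_left _ _)).trans (le_max_left _ _)) (hMF := ((le_max_right _ _).trans (le_max_left _ _)).trans (le_max_left _ _))
    (hMA := (le_max_right _ _).trans (le_max_left _ _)) (hMB := le_max_right _ _) (haP := le_rfl) (haG := le_rfl) (haF := le_rfl) (haA := le_rfl) (haB := le_rfl)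
    (hCS₂ := by positivity) (hCS₁ := by positivity) (hCD := by positivity)
    (hCY := fun β hβ hβ' => by have := hBh12 β hβ hβ'; have := hBhD β hβ hβ'; positivity) (hCXd := fun β hβ hβ' => by have := hBh12 β hβ hβ'; have := hBdX β hβ hβ'; positivity)
    (hCX := fun β hβ hβ' => by have := hBx13 β hβ hβ'; positivity)
    (hA₀ := hA0c0) (hAW := hADF0) (hCR := hCRF0) (hAD := hADA0) (hAQ1 := hAQ1A0) (hAQ := hAQA0)
    (hAI := fun ε hε => by have := hBi (min ε 1) (lt_min hε one_pos) (min_le_right _ _); positivity) (hAV := fun ε hε => by have := hBd ε hε; positivity)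
    (hθS₂ := le_max_left _ _) (hθS₁ := le_max_right _ _) (hθD₂ := le_max_left _ _) (hθD₁ := le_max_right _ _)
    (hθHY := fun β _ _ => le_max_left _ _) (hθHXd := fun β _ _ => (le_max_left _ _).trans (le_max_right _ _))
    (hθHXd₁ := fun β _ _ => ((le_max_left _ _).trans (le_max_right _ _)).trans (le_max_right _ _)) (hθHX₁ := fun β _ _ => ((le_max_right _ _).trans (le_max_right _ _)).trans (le_max_right _ _))
    (hδK₂ := by linarith) (hδK₁ := by linarith) (hδPG := le_rfl) (hδPF := by linarith) (hδPA := le_rfl) (hδPB := le_rfl) (hκS := le_rfl)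
    (hPairs := hPR) (hG0 := hPG0) (hSF := hSF) (hPA := hPA) (hPB := hPB)
  exact ⟨MS, (max (2 * ((A0c + (1 + CLip d ℓ) * AWA) * TS * rowConst261 (@geo9Y d ℓ hd hL b₀ b₁ Mstar) σ)) (2 * ((A0c + (1 + CLip d ℓ) * AWA) * TS * rowConst261 (@geo9Y d ℓ hd hL b₀ b₁ Mstar) σ) * (((ℓ + 1 : ℕ) : ℝ)))), (max (2 * ((B12₀ + (1 + CLip d ℓ) * B₃) * TS * rowConst261 (@geo9Y d ℓ hd hL b₀ b₁ Mstar) σ)) ((2 * ((B12₀ + (1 + CLip d ℓ) * B₃) * TS * rowConst261 (@geo9Y d ℓ hd hL b₀ b₁ Mstar) σ)) * (((ℓ + 1 : ℕ) : ℝ)))), A0c, ADF, AQA, ADA, AQ1A, CRF, (fun β : ℝ => max (2 * ((Bh12 β + (1 + CLip d ℓ) * BhD β) * TS * rowConst261 (@geo9Y d ℓ hd hL b₀ b₁ Mstar) σ)) (max (2 * ((Bh12 β + (1 + CLip d ℓ) * BdX β) * TS * rowConst261 (@geo9Y d ℓ hd hL b₀ b₁ Mstar) σ)) (max ((2 * ((Bh12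 β + (1 + CLip d ℓ) * BdX β) * TS * rowConst261 (@geo9Y d ℓ hd hL b₀ b₁ Mstar) σ)) * (((ℓ + 1 : ℕ) : ℝ))) ((2 * ((CX0 + (1 + CLip d ℓ) * (1 * (Bx13 β * (((ℓ + 1 : ℕ) : ℝ))) * ((w13 s44)⁻¹ * ((((ℓ + 1 : ℕ) : ℝ)) * Real.exp ((δ12₃ - τ) * (rNear d ℓ + 1)))) * rowConst261 (@geo9Y d ℓ hd hL b₀ b₁ Mstar) σ)) * TS * rowConst261 (@geo9Y d ℓ hd hL b₀ b₁ Mstar) σ)) * (((ℓ + 1 : ℕ) : ℝ)))))), fun ε : ℝ => ((ℓ + 1 : ℕ) : ℝ) * (((2 * (d + 1) : ℕ) : ℝ) * B12₀ + (coordBound39 (trBasis N) * ((d : ℝ) + 1) * basisBound39 (trBasis N) * Bi (min ε 1) * Real.exp (δ12₀ * (((d : ℝ) + 1) * (((ℓ : ℝ) + 1) + 1) + 2)) + ((2 * (d + 1) : ℕ) : ℝ) * B12₀ + coordBound39 (trBasis N) * basisBound39 (trBasis N) * (((2 * (d + 1) : ℕ) : ℝ) * B12₀))) * Real.exp (δ12₀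 * (rNear d ℓ + 1)), fun ε : ℝ => ((ℓ + 1 : ℕ) : ℝ) * (CW * (B12₃ * (((ℓ + 1 : ℕ) : ℝ))) + (coordBound39 (trBasis N) * ((d : ℝ) + 1) * basisBound39 (trBasis N) * Bd ε * Real.exp ((δ12₃ - τ) * (((d : ℝ) + 1) * (((ℓ : ℝ) + 1) + 1) + 2)) + CW * (B12₃ * (((ℓ + 1 : ℕ) : ℝ))) + coordBound39 (trBasis N) * basisBound39 (trBasis N) * (CW * (B12₃ * (((ℓ + 1 : ℕ) : ℝ)))))) * Real.exp ((δ12₃ - τ) * (rNear d ℓ + 1)),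
    le_max_of_le_left (by positivity), le_max_of_le_left (by positivity), fun β hβ hβ' => le_max_of_le_left (by have := hBh12 β hβ hβ'; have := hBhD β hβ hβ'; positivity),
    hA0c0, hADF0, hAQA0, hADA0, hAQ1A0, hCRF0,
    fun ε hε => by have := hBi (min ε 1) (lt_min hε one_pos) (min_le_right _ _); positivity,
    fun ε hε => by have := hBd ε hε; positivity,
    hFS⟩

end Summit.QuantumFields.YangMills.BalabanUVNodes.N06StateLayerAtPinsPUWParJ
end
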